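import Literature.NumberTheory.Sieve.PairProductSieveSequence
import Literature.NumberTheory.Sieve.SieveFunctionsProofs
import Literature.NumberTheory.LFunctions.MertensFormula
import Literature.NumberTheory.LFunctions.RHWave0PNTProofs
import Mathlib.Analysis.SpecialFunctions.ImproperIntegrals
import Mathlib.Analysis.Complex.ExponentialBounds
import Literature.Analysis.SpecialFunctions.EulerMascheroniBounds
import HarnessLib

/-!
# The least-`β` forms of the `β`-sieve bounds are false:
# `¬ SieveSequence.jurkat_richert_upper` and `¬ SieveSequence.jurkat_richert_lower`

Topic `Literature/NumberTheory/Sieve`; companion of `SieveFunctions.lean` (the least-`β` functions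
`upperSieveFun`, `lowerSieveFun` and their ERRATUM), `SieveFunctionsProofs.lean` (existence of
normalised solutions of the Rosser–Iwaniec system at EVERY positive zero of `q_κ`;
`siftingLimit_three_halves_lt`), `SieveAdjoint(P).lean` (the adjoints `q_κ`, `p_κ` and the
constant `A = 2(β − 1)^{κ−1}/p_κ(β − 1)`) and `PairProductSieveSequence.lean` (the test sequence).
Everything in this file is PROVED; the main theorems `SieveSequence.not_jurkat_richert_upper` and
`SieveSequence.not_jurkat_richert_lower` use only the standard axioms.

The refuted statements were the named facts `SieveSequence.jurkat_richert_upper` /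
`SieveSequence.jurkat_richert_lower` of `SieveFunctions.lean` (D-0014 sorry-sweep transcriptions);
since 2026-08-15 (defact verdict clean-up: a refuted `def … : Prop` is retired from the named-fact
registry, its `¬`-theorem kept) the two theorems below state the negated propositions VERBATIM
(the former `def` bodies, word for word), so that this file no longer depends on those names; the
faithful forms of Iwaniec's Theorem 1 are `SieveSequence.Iwaniec1980_upper` / `Iwaniec1980_lower`
(`SieveFunctions.lean`; both DISCHARGED, `SieveSequence.Iwaniec1980_upper_holds` /
`Iwaniec1980_lower_holds` in `RosserSieveBetaOneBound.lean`).

The former `SieveSequence.jurkat_richert_upper` transcribes the `β`-sieve upper bound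
`S(𝒜, z; x) ≤ X V(z) (F_κ(s) + ε)` (Iwaniec, *Rosser's sieve*, Acta Arith. 36 (1980), Thm 1;
for `κ = 1` Jurkat–Richert 1965) for EVERY `κ ≥ 1/2`, but with `F_κ` replaced by
`upperSieveFun κ`, the `F` of the LEAST admissible `β` (`IsBetaSieveData`), whereas Iwaniec's
`β_κ` is `1 +` the GREATEST zero of `q_κ` (Greaves, *Sieves in Number Theory*, (4.2.4.10)). For
`κ = 2`, `q_2(u) = u³ − 6u² + 9u − 8/3` (Greaves (4.2.3.3)) has the zeros `0.392…, 1.773…,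
3.833…`; the least gives `siftingLimit 2 < 1.393` and `upperSieveFun 2 2 = A/4 ≤ 0.4703`, and this
"bound" fails for an explicit sequence.

## The counterexample (`κ = 2`, `θ = 1/2`, `s = 2`)

The pair-product sequence `𝒜` of `PairProductSieveSequence.lean` (`a_n = #{(m₁, m₂) : m₁ m₂ = n`,
`m₁, m₂` in a common dyadic block`}`, density `g(p) = 1 − (1 − 1/p)²`) satisfies `Ω(2, L)`
(`hasIwaniecDimension_two`, from Mertens' product theorem with rate,
`Literature.NumberTheory.LFunctions.Mertens.abs_mertensLog_sub_le`) and has level of distribution `1/2`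
(`hasLevelOfDistribution_pairProducts`). At `x = 16^J`, `z = 2^J = x^{1/4}` (`δ = 1/4`,
`θ log x / log z = 2`), `ε = 1/100`, the fact would give, for all large `J`,
`S(𝒜, z; x) ≤ X(x) V(z) (upperSieveFun 2 2 + 1/100) ≤ (16^J + 2)/3 · e^{−2γ} e^{50/(J log 2)}
(J log 2)⁻² · 0.4803 ≤ 0.0617 · 16^J/(J log 2)²` (`e^{−2γ} < e^{−1} < 0.3679`, `J ≥ 6000`), whereas
the pairs of primes `≥ 2^J` in the blocks `J ≤ k < 2J` survive the sieve and the prime number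
theorem (`Literature.NumberTheory.LFunctions.primeCounting_isEquivalent_holds`, along `2^k`) gives
`S(𝒜, z; x) ≥ ∑_{J ≤ k < 2J} (0.95 · 2^k/(k log 2))² ≥ 0.95² (16^J − 4^J)/(12 J² log² 2)
≥ 0.0744 · 16^J/(J log 2)²`. (Asymptotically `S/(X V) → e^{2γ}/4 = 0.793…`; Iwaniec's genuine
bound `F_2(2) + ε = A_2/4 + ε = 10.87… + ε` is of course not contradicted.)

## The lower bound (the former `SieveSequence.jurkat_richert_lower`)

The same data refute the least-`β` LOWER bound `S ≥ X V(z) (lowerSieveFun κ (s) − ε)`: the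
least-`β` `f` of dimension `2` vanishes only up to `β = 1.39…` and, integrating
`(s² f)' = 2 s F(s − 1) = 2As/(s − 1)²` from `β` to `2`, `lowerSieveFun 2 2 = (A/2)(1/u − 1 − log u)
≥ 1.30` (`u = β − 1 ∈ (0.390, 0.393)` from `q_2 < 0` on `(0, 0.39]`; `A = 2u/p_2(u) ≥ 1.068` from
`p_2(u) ≤ 0.73`, an elementary estimate of the Laplace integral with `Ein x ≥ log (1 + x)`),
whereas Iwaniec's `f_2(2) = 0` (`2 < β_2`). So the fact would give
`S ≥ (16^J − 1)/3 · e^{−2γ} e^{−50/(J log 2)} (J log 2)⁻² · 1.29 ≥ 0.127 · 16^J/(J log 2)²`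
(`e^{−2γ} ≥ 0.3`), while in the blocks `k < 2J` only `1` and the primes `≥ 2^J` survive the sieve,
so that the prime number theorem (upper direction) gives
`S ≤ J + 1 + ∑_{J ≤ k < 2J} (1.01 · 2^k/(k log 2))² ≤ J + 1 + 0.105 · 16^J/(J log 2)²`.

## Contents (all proved)

* `SieveAdjoint.rLadder_zero_four`, `SieveAdjoint.qFun_two` (`q_2 = u³ − 6u² + 9u − 8/3`),
  `SieveAdjoint.exists_small_zero_qFun_two` (a zero in `(0.390, 0.393)`);
  `BetaSieveForward.exists_isBetaSieveSolution_two_small`, `siftingLimit_two_lt`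
  (`siftingLimit 2 < 1.393`), `one_lt_siftingLimit_two`, `inv_add_le_rosserAdjointP`
  (`p_κ(s) ≥ 1/(s + κ)`), `betaSieveConst_two_le`, `upperSieveFun_two_two`,
  `upperSieveFun_two_two_le` (`≤ 0.4703`).
* `PairProducts.mertensProd` (`Π(y) = ∏_{p<y} (1 − 1/p)⁻¹` for real `y`),
  `PairProducts.abs_log_mertensProd_sub_le` (`|log Π(y) − log log y − γ| ≤ 25/log y`, `y ≥ 2`),
  `PairProducts.hasIwaniecDimension_two` (`Ω(2, 100 e^{100/log 2})` for every density with
  `g(p) = 1 − (1 − 1/p)²`), `PairProducts.prod_one_sub_inv_sq_le`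
  (`∏_{p<z} (1 − 1/p)² ≤ e^{−2γ} (log z)⁻² e^{50/log z}`).
* `PairProducts.eventually_abs_primeCounting_two_pow_sub_le` (PNT along `2^k`),
  `PairProducts.eventually_card_block_primes_ge` (`#{p ∈ [2^k, 2^{k+1})} ≥ (1 − η) 2^k/(k log 2)`
  eventually).
* `SieveSequence.not_jurkat_richert_upper : ¬ ∀ A κ L θ …` (the least-`β` upper bound, stated verbatim).
* Lower bound: `integral_inv_one_add_pow_two`, `rosserAdjointP_two_integrand_le`, `rosserAdjointP_two_le`
  (`p_2(u) ≤ 0.73` for `u ≥ 0.39`), `siftingLimit_two_gt` (`> 1.39`), `betaSieveConst_two_ge`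
  (`≥ 1.068`), `lowerSieveFun_two_two_ge` (`≥ 1.30`); `PairProducts.prod_one_sub_inv_sq_ge`,
  `PairProducts.size_sixteen_pow_ge`, `PairProducts.prime_of_mem_block_of_coprime`,
  `PairProducts.sifted_le_sum_sq_card_primes`, `PairProducts.eventually_card_block_primes_le`,
  `PairProducts.sum_four_pow_div_sq_le`, `PairProducts.three_tenths_le_exp_neg_two_mul_eulerMascheroni`;
  `SieveSequence.not_jurkat_richert_lower : ¬ ∀ A κ L θ …` (the least-`β` lower bound, stated verbatim).

## References

* H. Iwaniec, *Rosser's sieve*, Acta Arith. 36 (1980), 171–202, Thm 1. [IwaniecActaArith1980]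
* G. Greaves, *Sieves in Number Theory*, Springer (2001), §4.2.3 (3.3) (the polynomials `q` for
  `2κ ∈ ℕ`, `q_2 = s³ − 6s² + 9s − 8/3`), (4.2.3.18), (4.2.4.10), Lemma 4.2.6. [Greaves2001]
* G. H. Hardy, E. M. Wright, *An Introduction to the Theory of Numbers*, 6th ed., Thm 429
  (Mertens' product theorem). [HardyWright2008]
* H. L. Montgomery, R. C. Vaughan, *Multiplicative Number Theory I*, CUP 2007, §8.1 (8.1)
  (prime number theorem). [MontgomeryVaughan2007]
-/

open Finset Filter Asymptotics MeasureTheory intervalIntegral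

noncomputable section

namespace Literature.NumberTheory.Sieve

/-! ## Dimension `2`: the least admissible `β` and its constant -/

namespace SieveAdjoint

/-- The rung at level `4` from `x₀ = 0`:
`r(s) = s³ − 3b s² + (3b² − 3b/2) s − b³ + (3/2) b² − b/3`. [cite: Greaves2001, (4.2.3.18)] -/
theorem rLadder_zero_four (b s : ℝ) :
    rLadder b 0 4 s =
      s ^ 3 - 3 * b * s ^ 2 + (3 * b ^ 2 - 3 * b / 2) * s - b ^ 3 + 3 / 2 * b ^ 2 - b / 3 := by
  rw [show (4 : ℕ) = 3 + 1 from rfl, rLadder_succ]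
  have hI : ∀ u v : ℝ, ∫ t in u..v, rLadder b 0 3 t =
      (v ^ 3 - u ^ 3) / 3 - b * (v ^ 2 - u ^ 2) + (b ^ 2 - b / 2) * (v - u) := by
    intro u v
    simp only [rLadder_zero_three]
    have e : (fun t : ℝ => t ^ 2 - 2 * b * t + b ^ 2 - b / 2) =
        fun t : ℝ => (t ^ 2 + (-(2 * b)) * t) + (b ^ 2 - b / 2) := by
      funext t; ring
    rw [e]
    have h1 : IntervalIntegrable (fun t : ℝ => t ^ 2) volume u v := (continuous_pow 2).intervalIntegrable _ _
    have h2 : IntervalIntegrable (fun t : ℝ => (-(2 * b)) * t) volume u v :=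
      (continuous_const.mul continuous_id).intervalIntegrable _ _
    have h3 : IntervalIntegrable (fun _ : ℝ => b ^ 2 - b / 2) volume u v :=
      continuous_const.intervalIntegrable _ _
    rw [intervalIntegral.integral_add (h1.add h2) h3, intervalIntegral.integral_add h1 h2,
      integral_pow, intervalIntegral.integral_const_mul, integral_id, intervalIntegral.integral_const,
      smul_eq_mul]
    push_cast
    ring
  rw [hI, hI, rLadder_zero_three]
  push_cast
  ring

/-- **`q_2(u) = u³ − 6u² + 9u − 8/3`** (Greaves, *Sieves in Number Theory*, (4.2.3.3); Iwaniec 1980,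
§5.1 Example 2; the polynomial of `isSieveAdjoint_two` in `SieveAdjoint.lean`): the ladder reproduces the
printed polynomial for `κ = 2`. [cite: Greaves2001, §4.2.3 (4.2.3.3)] -/
theorem qFun_two (s : ℝ) : qFun 2 s = s ^ 3 - 6 * s ^ 2 + 9 * s - 8 / 3 := by
  have hf : ⌊2 * (2 : ℝ)⌋₊ = 4 := by norm_num
  simp only [qFun, hf]
  norm_num
  rw [rLadder_zero_four]
  ring

/-- `q_2` has a zero in `(0.390, 0.393)` (its least positive zero `0.39208…`; the other two are
`1.7739…` and Iwaniec's `β_2 − 1 = 3.8339…`). [folklore] -/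
theorem exists_small_zero_qFun_two :
    ∃ ρ : ℝ, 39 / 100 < ρ ∧ ρ < 393 / 1000 ∧ qFun 2 ρ = 0 := by
  set g : ℝ → ℝ := fun s => s ^ 3 - 6 * s ^ 2 + 9 * s - 8 / 3 with hg
  have hcont : ContinuousOn g (Set.Icc (39 / 100) (393 / 1000)) := by
    simp only [hg]; fun_prop
  have ha : g (39 / 100) < 0 := by simp only [hg]; norm_num
  have hb : 0 < g (393 / 1000) := by simp only [hg]; norm_num
  have h0 : (0 : ℝ) ∈ Set.Ioo (g (39 / 100)) (g (393 / 1000)) := ⟨ha, hb⟩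
  obtain ⟨ρ, hρ, hρ0⟩ := intermediate_value_Ioo (by norm_num) hcont h0
  exact ⟨ρ, hρ.1, hρ.2, by rw [qFun_two]; exact hρ0⟩

end SieveAdjoint

open SieveAdjoint


/-- **A normalised solution of dimension `2` below `β = 1.393`**: at the least zero
`ρ = 0.392…` of `q_2` the normalised `β`-sieve system of dimension `2` is solvable
(`exists_isBetaSieveSolution_of_qFun_eq_zero`), with `β = 1 + ρ ∈ (1.390, 1.393)` — far below
Iwaniec's `β_2 = 4.8339…`. [cite: Greaves2001, Lemma 4.2.6] -/
theorem BetaSieveForward.exists_isBetaSieveSolution_two_small :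
    ∃ β : ℝ, 139 / 100 < β ∧ β < 1393 / 1000 ∧
      ∃ F f : ℝ → ℝ, ∃ A : ℝ, IsBetaSieveSolution 2 F f β A := by
  obtain ⟨ρ, h1, h2, h0⟩ := exists_small_zero_qFun_two
  refine ⟨1 + ρ, by linarith, by linarith, ?_⟩
  exact BetaSieveForward.exists_isBetaSieveSolution_of_qFun_eq_zero (by norm_num) (by linarith) h0

/-- **`siftingLimit 2 < 1.393`**: the least admissible `β` of dimension `2` (the `β` of
`upperSieveFun 2`, `lowerSieveFun 2`) lies below `1.393`, whereas Iwaniec's sifting limit is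
`β_2 = 4.8339…` (Diamond–Halberstam–Galway, Table 15.3). [folklore] -/
theorem siftingLimit_two_lt : siftingLimit 2 < 1393 / 1000 := by
  have h := isBetaSieveData_betaSieveData' (κ := 2) (by norm_num)
  obtain ⟨β, -, h2, F, f, A, hS⟩ := BetaSieveForward.exists_isBetaSieveSolution_two_small
  exact lt_of_le_of_lt (h.2 F f β A hS) h2

/-- `1 < siftingLimit 2` (`β > 1` for every solution of dimension `κ ≥ 1`). [folklore] -/
theorem one_lt_siftingLimit_two : 1 < siftingLimit 2 :=
  (isBetaSieveSolution_upperSieveFun_lowerSieveFun exists_isBetaSieveData_holds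
    (by norm_num : (1 : ℝ) / 2 ≤ 2)).one_lt (by norm_num)

/-- `p_κ(s) ≥ 1/(s + κ)` for `κ ≥ 0`, `s > 0` (`Ein x ≤ x`). [folklore] -/
theorem inv_add_le_rosserAdjointP {κ s : ℝ} (hκ : 0 ≤ κ) (hs : 0 < s) :
    1 / (s + κ) ≤ rosserAdjointP κ s := by
  rw [rosserAdjointP_def]
  have hsk : 0 < s + κ := by linarith
  have h1 : ∫ x in Set.Ioi (0 : ℝ), Real.exp (-(s + κ) * x) = 1 / (s + κ) := by
    rw [integral_exp_mul_Ioi (by linarith) 0, mul_zero, Real.exp_zero]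
    field_simp
  rw [← h1]
  refine setIntegral_mono_on (integrableOn_exp_mul_Ioi (by linarith) 0)
    (rosserAdjointP.integrableOn_integrand hκ hs) measurableSet_Ioi fun x hx => ?_
  rw [Real.exp_le_exp]
  have := ein_le_self (le_of_lt (α := ℝ) hx)
  nlinarith

/-- **`A_2'' ≤ 1.881`** for the constant of the least-`β` data of dimension `2`:
`betaSieveConst 2 = 2 (β − 1)/p_2(β − 1) ≤ 2 (β − 1)(β + 1) < 2 · 0.393 · 2.393`
(`β = siftingLimit 2 < 1.393`, `p_2(u) ≥ 1/(u + 2)`). (Iwaniec's constant is `A_2 = 43.49…`.)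
[folklore] -/
theorem betaSieveConst_two_le : betaSieveConst 2 ≤ 2 * (393 / 1000) * (2393 / 1000) := by
  have hβ1 := one_lt_siftingLimit_two
  have hβ2 := siftingLimit_two_lt
  set u := siftingLimit 2 - 1 with hu
  have hu0 : 0 < u := by linarith
  have hA : betaSieveConst 2 = 2 * u / rosserAdjointP 2 u := by
    rw [betaSieveConst_eq exists_isBetaSieveData_holds (by norm_num : (1 : ℝ) ≤ 2), hu]
    norm_num
  have hp : 1 / (u + 2) ≤ rosserAdjointP 2 u := inv_add_le_rosserAdjointP (by norm_num) hu0
  have hp0 : 0 < 1 / (u + 2) := by positivity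
  rw [hA, div_le_iff₀ (lt_of_lt_of_le hp0 hp)]
  calc 2 * u = 2 * u * (u + 2) * (1 / (u + 2)) := by field_simp
    _ ≤ 2 * (393 / 1000) * (2393 / 1000) * (1 / (u + 2)) := by
        gcongr 2 * ?_ * ?_ * _ <;> linarith
    _ ≤ 2 * (393 / 1000) * (2393 / 1000) * rosserAdjointP 2 u := by gcongr

/-- `upperSieveFun 2 2 = betaSieveConst 2 / 4` (`F(s) = A s^{−2}` on `(0, β + 1] ∋ 2`). [folklore] -/
theorem upperSieveFun_two_two : upperSieveFun 2 2 = betaSieveConst 2 / 4 := by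
  have h := isBetaSieveSolution_upperSieveFun_lowerSieveFun exists_isBetaSieveData_holds
    (by norm_num : (1 : ℝ) / 2 ≤ 2)
  rw [h.upper_eq 2 ⟨by norm_num, by linarith [h.one_le]⟩]
  rw [show ((2 : ℝ) ^ (-(2 : ℝ))) = 1 / 4 by
    rw [Real.rpow_neg (by norm_num), Real.rpow_two]; norm_num]
  ring

/-- **`upperSieveFun 2 2 ≤ 0.4703`**, whereas for the pair-product sequence at `s = 2` the true
normalised sifted ratio tends to `e^{2γ}/4 = 0.793…`. [folklore] -/
theorem upperSieveFun_two_two_le : upperSieveFun 2 2 ≤ 4703 / 10000 := by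
  rw [upperSieveFun_two_two]
  linarith [betaSieveConst_two_le]

/-! ## Mertens' product below a real bound; the dimension condition and `V(z)` -/

namespace PairProducts

/-- `mertensProd y = Π(y) = ∏_{p < y} (1 − 1/p)⁻¹` over the primes below the real number `y`.
[folklore] -/
def mertensProd (y : ℝ) : ℝ := ∏ p ∈ Nat.primesBelow ⌈y⌉₊, (1 - (p : ℝ)⁻¹)⁻¹

/-- `Π(y) > 0`. [folklore] -/
theorem mertensProd_pos (y : ℝ) : 0 < mertensProd y := by
  refine prod_pos fun p hp => inv_pos.mpr ?_
  have hp2 : (2 : ℝ) ≤ p := by exact_mod_cast (Nat.prime_of_mem_primesBelow hp).two_le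
  have : (p : ℝ)⁻¹ ≤ 1 / 2 := by rw [inv_eq_one_div]; gcongr
  linarith

/-- `Π(y) = exp A(⌈y⌉ − 1)` with `A = Literature.Nicolas.mertensLog` (`p < y ↔ p ≤ ⌈y⌉ − 1`). [folklore] -/
theorem mertensProd_eq_exp (y : ℝ) :
    mertensProd y = Real.exp (Literature.NumberTheory.LFunctions.Nicolas.mertensLog ((⌈y⌉₊ - 1 : ℕ) : ℝ)) := by
  rw [mertensProd, Nat.primesBelow_eq_primesLE_sub_one, ← Literature.NumberTheory.LFunctions.Mertens.prod_one_sub_inv_inv_eq_exp,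
    Nat.floor_natCast]

/-- `Π(y) = 1` for `y ≤ 2` and `Π(y) = 2` for `2 < y ≤ 3`. [folklore] -/
theorem log_mertensProd_of_lt_three {y : ℝ} (hy : 2 ≤ y) (hy3 : y < 3) :
    Real.log (mertensProd y) = 0 ∨ Real.log (mertensProd y) = Real.log 2 := by
  rcases hy.eq_or_lt with rfl | hy2
  · left
    rw [mertensProd, show ⌈(2 : ℝ)⌉₊ = 2 by norm_num, Nat.primesBelow_two, prod_empty, Real.log_one]
  · right
    have hc : ⌈y⌉₊ = 3 := (Nat.ceil_eq_iff (by norm_num)).mpr ⟨by norm_num; linarith, by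
      norm_num; linarith⟩
    rw [mertensProd, hc, show Nat.primesBelow 3 = {2} by decide, prod_singleton]
    norm_num

/-- **Mertens' product theorem for `Π(y) = ∏_{p<y} (1 − 1/p)⁻¹`, real cut-off**:
`|log Π(y) − log log y − γ| ≤ 25/log y` for `y ≥ 2` (from `Literature.NumberTheory.LFunctions.Mertens.abs_mertensLog_sub_le`,
the rate `12/log x` at the integer `⌈y⌉ − 1 ∈ [y − 1, y)`, with `log(⌈y⌉ − 1) ≥ (log y)/2` for
`y ≥ 3`). [cite: HardyWright2008, Thm 429 (§22.8)] -/
theorem abs_log_mertensProd_sub_le {y : ℝ} (hy : 2 ≤ y) :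
    |Real.log (mertensProd y) - Real.log (Real.log y) - Real.eulerMascheroniConstant| ≤
      25 / Real.log y := by
  have hlogy : 0 < Real.log y := Real.log_pos (by linarith)
  have hγ1 := Real.one_half_lt_eulerMascheroniConstant
  have hγ2 := Real.eulerMascheroniConstant_lt_two_thirds
  rcases lt_or_ge y 3 with hy3 | hy3
  · -- small `y`: everything is `O(1)` and `25 / log y > 12`
    have hl2 := Real.log_two_gt_d9
    have hl2' := Real.log_two_lt_d9
    have hlogy3 : Real.log y < 2 := by
      calc Real.log y < Real.log 4 := Real.log_lt_log (by linarith) (by linarith)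
        _ = 2 * Real.log 2 := by rw [show (4 : ℝ) = 2 ^ 2 by norm_num, Real.log_pow]; norm_num
        _ < 2 := by linarith
    have hlogy2 : Real.log 2 ≤ Real.log y := Real.log_le_log two_pos hy
    -- `|log log y| ≤ 1`
    have hll1 : Real.log (Real.log y) ≤ 1 := by
      calc Real.log (Real.log y) ≤ Real.log y - 1 := Real.log_le_sub_one_of_pos hlogy
        _ ≤ 1 := by linarith
    have hll2 : -1 ≤ Real.log (Real.log y) := by
      have h1 : Real.log (1 / 2) ≤ Real.log (Real.log y) :=
        Real.log_le_log (by norm_num) (by linarith)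
      have h2 : -1 ≤ Real.log (1 / 2) := by
        rw [one_div, Real.log_inv]; linarith
      linarith
    have hP : 0 ≤ Real.log (mertensProd y) ∧ Real.log (mertensProd y) ≤ 1 := by
      rcases log_mertensProd_of_lt_three hy hy3 with h | h <;> rw [h]
      · exact ⟨le_rfl, zero_le_one⟩
      · exact ⟨by linarith, by linarith⟩
    have hbound : |Real.log (mertensProd y) - Real.log (Real.log y) - Real.eulerMascheroniConstant| ≤ 3 := by
      rw [abs_le]; constructor <;> linarith [hP.1, hP.2]
    refine hbound.trans ?_
    rw [le_div_iff₀ hlogy]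
    linarith
  · -- `y ≥ 3`: the integer `T = ⌈y⌉ − 1 ≥ 2` satisfies `y − 1 ≤ T < y`
    set n := ⌈y⌉₊ with hn
    have hyn : y ≤ n := Nat.le_ceil y
    have hny : (n : ℝ) < y + 1 := Nat.ceil_lt_add_one (by linarith)
    have hn3 : 3 ≤ n := by
      have : (3 : ℝ) ≤ n := hy3.trans hyn
      exact_mod_cast this
    set T := n - 1 with hT
    have hTn : (T : ℝ) = n - 1 := by rw [hT, Nat.cast_sub (by omega)]; norm_num
    have hT2 : (2 : ℝ) ≤ T := by
      rw [hTn]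
      have h3 : (3 : ℝ) ≤ (n : ℝ) := by exact_mod_cast hn3
      linarith
    have hTy : (T : ℝ) < y := by rw [hTn]; linarith
    have hyT : y ≤ T + 1 := by rw [hTn]; linarith
    have hT0 : (0 : ℝ) < T := by linarith
    have hlogT : 0 < Real.log T := Real.log_pos (by linarith)
    have hlogTy : Real.log T ≤ Real.log y := Real.log_le_log hT0 hTy.le
    -- the identity `log Π(y) = A(T)`
    have hlogP : Real.log (mertensProd y) = Literature.NumberTheory.LFunctions.Nicolas.mertensLog T := by
      rw [mertensProd_eq_exp, Real.log_exp]
    have h12 := Literature.NumberTheory.LFunctions.Mertens.abs_mertensLog_sub_le hT2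
    -- `0 ≤ log log y − log log T ≤ 1/(2 log T)`
    have hll0 : 0 ≤ Real.log (Real.log y) - Real.log (Real.log T) := by
      linarith [Real.log_le_log hlogT hlogTy]
    have hll : Real.log (Real.log y) - Real.log (Real.log T) ≤ 1 / (2 * Real.log T) := by
      have h1 : Real.log (Real.log y) - Real.log (Real.log T) =
          Real.log (Real.log y / Real.log T) := by
        rw [Real.log_div hlogy.ne' hlogT.ne']
      have h2 : Real.log (Real.log y / Real.log T) ≤ Real.log y / Real.log T - 1 :=
        Real.log_le_sub_one_of_pos (div_pos hlogy hlogT)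
      have h3 : Real.log y - Real.log T ≤ 1 / T := by
        have h4 : Real.log y ≤ Real.log (T + 1) := Real.log_le_log (by linarith) hyT
        have h5 : Real.log (T + 1) - Real.log T = Real.log (1 + 1 / T) := by
          rw [← Real.log_div (by linarith) hT0.ne']; congr 1; field_simp
        have h6 : Real.log (1 + 1 / T) ≤ 1 / T := by
          have := Real.log_le_sub_one_of_pos (show (0 : ℝ) < 1 + 1 / T by positivity); linarith
        linarith
      have h7 : 1 / (T : ℝ) ≤ 1 / 2 := by gcongr
      rw [h1]
      calc Real.log (Real.log y / Real.log T) ≤ Real.log y / Real.log T - 1 := h2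
        _ = (Real.log y - Real.log T) / Real.log T := by field_simp
        _ ≤ (1 / 2) / Real.log T := by gcongr; linarith
        _ = 1 / (2 * Real.log T) := by field_simp
    -- `log y ≤ 2 log T` since `T ≥ y − 1` and `(y − 1)² ≥ y` for `y ≥ 3`
    have hhalf : Real.log y ≤ 2 * Real.log T := by
      have e : 2 * Real.log T = Real.log ((T : ℝ) ^ 2) := by rw [Real.log_pow]; norm_num
      rw [e]
      refine Real.log_le_log (by linarith) ?_
      nlinarith
    -- assemble
    have key : |Real.log (mertensProd y) - Real.log (Real.log y) - Real.eulerMascheroniConstant| ≤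
        25 / (2 * Real.log T) := by
      rw [hlogP]
      have e : Literature.NumberTheory.LFunctions.Nicolas.mertensLog T - Real.log (Real.log y) - Real.eulerMascheroniConstant =
          (Literature.NumberTheory.LFunctions.Nicolas.mertensLog T - Real.log (Real.log T) - Real.eulerMascheroniConstant) -
            (Real.log (Real.log y) - Real.log (Real.log T)) := by ring
      rw [e]
      refine (abs_sub _ _).trans ?_
      rw [abs_of_nonneg hll0]
      calc |Literature.NumberTheory.LFunctions.Nicolas.mertensLog T - Real.log (Real.log T) - Real.eulerMascheroniConstant| +
            (Real.log (Real.log y) - Real.log (Real.log T))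
          ≤ 12 / Real.log T + 1 / (2 * Real.log T) := add_le_add h12 hll
        _ = 25 / (2 * Real.log T) := by field_simp; ring
    refine key.trans ?_
    rw [div_le_div_iff₀ (by positivity) hlogy]
    nlinarith

/-! ### The dimension condition `Ω(2, L)` and the upper bound for `V(z)` -/

/-- `e^t ≤ 1 + t e^t` for `t ≥ 0`. [folklore] -/
theorem exp_le_one_add_mul_exp (t : ℝ) : Real.exp t ≤ 1 + t * Real.exp t := by
  have h := Real.add_one_le_exp (-t)
  have hpos := Real.exp_pos t
  have h1 : (-t + 1) * Real.exp t ≤ Real.exp (-t) * Real.exp t :=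
    mul_le_mul_of_nonneg_right h hpos.le
  rw [← Real.exp_add, neg_add_cancel, Real.exp_zero] at h1
  nlinarith

/-- The primes below `w` are the primes below `z ≥ w` that are `< w`. [folklore] -/
theorem primesBelow_ceil_eq_filter {w z : ℝ} (hwz : w ≤ z) :
    Nat.primesBelow ⌈w⌉₊ = (Nat.primesBelow ⌈z⌉₊).filter (fun p : ℕ => ¬ w ≤ (p : ℝ)) := by
  ext p
  simp only [Nat.mem_primesBelow, mem_filter, not_le, Nat.lt_ceil]
  constructor
  · rintro ⟨h1, h2⟩; exact ⟨⟨h1.trans_le hwz, h2⟩, h1⟩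
  · rintro ⟨⟨-, h2⟩, h1⟩; exact ⟨h1, h2⟩

/-- `∏_{w ≤ p < z} (1 − 1/p)⁻¹ = Π(z)/Π(w)` for `w ≤ z`. [folklore] -/
theorem prod_filter_eq_mertensProd_div {w z : ℝ} (hwz : w ≤ z) :
    ∏ p ∈ (Nat.primesBelow ⌈z⌉₊).filter (fun p : ℕ => w ≤ (p : ℝ)), (1 - (p : ℝ)⁻¹)⁻¹ =
      mertensProd z / mertensProd w := by
  rw [eq_div_iff (mertensProd_pos w).ne', mertensProd, mertensProd, primesBelow_ceil_eq_filter hwz,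
    prod_filter_mul_prod_filter_not]

/-- **The pair-product density has Iwaniec dimension `Ω(2, L)`** with `L = 100 e^{100/log 2}`: for a
multiplicative `g` with `g(p) = 1 − (1 − 1/p)²` on the primes and all `2 ≤ w ≤ z`,
`∏_{w ≤ p < z} (1 − g(p))⁻¹ = (Π(z)/Π(w))² ≤ (log z/log w)² e^{100/log w} ≤ (log z/log w)² (1 + L/log w)`
(Mertens' product theorem with rate, `abs_log_mertensProd_sub_le`). [cite: HardyWright2008, Thm 429 (§22.8)] -/
theorem hasIwaniecDimension_two {g : ArithmeticFunction ℝ}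
    (hg : ∀ p : ℕ, p.Prime → g p = 1 - (1 - (p : ℝ)⁻¹) ^ 2) :
    HasIwaniecDimension g 2 (100 * Real.exp (100 / Real.log 2)) := by
  have hfac : ∀ p : ℕ, p.Prime → (1 / 2 : ℝ) ≤ 1 - (p : ℝ)⁻¹ ∧ 1 - (p : ℝ)⁻¹ < 1 := by
    intro p hp
    have hp2 : (2 : ℝ) ≤ p := by exact_mod_cast hp.two_le
    have h1 : (p : ℝ)⁻¹ ≤ 1 / 2 := by rw [inv_eq_one_div]; gcongr
    have h2 : 0 < (p : ℝ)⁻¹ := by positivity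
    constructor <;> linarith
  refine ⟨fun p hp => ?_, fun w z hw hwz => ?_⟩
  · rw [hg p hp]
    obtain ⟨h1, h2⟩ := hfac p hp
    constructor <;> nlinarith
  have hlogw : 0 < Real.log w := Real.log_pos (by linarith)
  have hlogz : 0 < Real.log z := Real.log_pos (by linarith)
  have hlog2w : Real.log 2 ≤ Real.log w := Real.log_le_log two_pos hw
  have hlog2 : 0 < Real.log 2 := Real.log_pos one_lt_two
  -- the product is `(Π(z)/Π(w))²`
  have hprod : ∏ p ∈ (Nat.primesBelow ⌈z⌉₊).filter (fun p : ℕ => w ≤ (p : ℝ)), (1 - g p)⁻¹ =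
      (mertensProd z / mertensProd w) ^ 2 := by
    rw [← prod_filter_eq_mertensProd_div hwz, ← prod_pow]
    refine prod_congr rfl fun p hp => ?_
    rw [mem_filter] at hp
    rw [hg p (Nat.prime_of_mem_primesBelow hp.1), sub_sub_cancel, inv_pow]
  rw [hprod]
  -- logarithmic form
  set R := mertensProd z / mertensProd w with hR
  have hRpos : 0 < R := div_pos (mertensProd_pos z) (mertensProd_pos w)
  obtain ⟨-, hz2⟩ := abs_le.mp (abs_log_mertensProd_sub_le (le_trans hw hwz))
  obtain ⟨hw1, -⟩ := abs_le.mp (abs_log_mertensProd_sub_le hw)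
  have hlogR : Real.log R ≤ Real.log (Real.log z) - Real.log (Real.log w) + 50 / Real.log w := by
    rw [hR, Real.log_div (mertensProd_pos z).ne' (mertensProd_pos w).ne']
    have : 25 / Real.log z ≤ 25 / Real.log w :=
      div_le_div_of_nonneg_left (by norm_num) hlogw (Real.log_le_log (by linarith) hwz)
    have e50 : (50 : ℝ) / Real.log w = 2 * (25 / Real.log w) := by ring
    linarith
  set t := 100 / Real.log w with ht_def
  have ht0 : 0 ≤ t := by positivity
  have htle : t ≤ 100 / Real.log 2 := div_le_div_of_nonneg_left (by norm_num) hlog2 hlog2w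
  have hR2 : R ^ 2 ≤ (Real.log z / Real.log w) ^ (2 : ℝ) * Real.exp t := by
    have e1 : R ^ 2 = Real.exp (2 * Real.log R) := by
      have : Real.log (R ^ 2) = 2 * Real.log R := by rw [Real.log_pow]; norm_num
      rw [← this, Real.exp_log (pow_pos hRpos 2)]
    have e2 : (Real.log z / Real.log w) ^ (2 : ℝ) * Real.exp t =
        Real.exp (2 * (Real.log (Real.log z) - Real.log (Real.log w)) + t) := by
      rw [Real.exp_add, show 2 * (Real.log (Real.log z) - Real.log (Real.log w)) =
        (Real.log (Real.log z) - Real.log (Real.log w)) + (Real.log (Real.log z) - Real.log (Real.log w))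
        by ring, Real.exp_add, Real.exp_sub, Real.exp_log hlogz, Real.exp_log hlogw, Real.rpow_two]
      ring
    rw [e1, e2, Real.exp_le_exp, ht_def]
    have e100 : (100 : ℝ) / Real.log w = 2 * (50 / Real.log w) := by ring
    linarith
  calc R ^ 2 ≤ (Real.log z / Real.log w) ^ (2 : ℝ) * Real.exp t := hR2
    _ ≤ (Real.log z / Real.log w) ^ (2 : ℝ) * (1 + t * Real.exp (100 / Real.log 2)) := by
        gcongr
        calc Real.exp t ≤ 1 + t * Real.exp t := exp_le_one_add_mul_exp t
          _ ≤ 1 + t * Real.exp (100 / Real.log 2) := by gcongr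
    _ = (Real.log z / Real.log w) ^ (2 : ℝ) * (1 + 100 * Real.exp (100 / Real.log 2) / Real.log w) := by
        rw [ht_def]; ring

/-- **Upper bound for `V(z)`**: for `z ≥ 2`,
`∏_{p<z} (1 − 1/p)² = Π(z)⁻² ≤ e^{−2γ} (log z)⁻² e^{50/log z}`. [cite: HardyWright2008, Thm 429 (§22.8)] -/
theorem prod_one_sub_inv_sq_le {z : ℝ} (hz : 2 ≤ z) :
    ∏ p ∈ Nat.primesBelow ⌈z⌉₊, (1 - (p : ℝ)⁻¹) ^ 2 ≤
      Real.exp (-2 * Real.eulerMascheroniConstant) * (Real.log z) ^ (-(2 : ℝ)) *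
        Real.exp (50 / Real.log z) := by
  have hlogz : 0 < Real.log z := Real.log_pos (by linarith)
  obtain ⟨h1, -⟩ := abs_le.mp (abs_log_mertensProd_sub_le hz)
  have hP := mertensProd_pos z
  have e1 : ∏ p ∈ Nat.primesBelow ⌈z⌉₊, (1 - (p : ℝ)⁻¹) ^ 2 = Real.exp (-2 * Real.log (mertensProd z)) := by
    have e3 : ∏ p ∈ Nat.primesBelow ⌈z⌉₊, (1 - (p : ℝ)⁻¹) ^ 2 = ((mertensProd z)⁻¹) ^ 2 := by
      rw [mertensProd, ← prod_inv_distrib, ← prod_pow]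
      exact prod_congr rfl fun p _ => by rw [inv_inv]
    have e4 : Real.log (((mertensProd z)⁻¹) ^ 2) = -2 * Real.log (mertensProd z) := by
      rw [Real.log_pow, Real.log_inv]; push_cast; ring
    rw [e3, ← e4, Real.exp_log (by positivity)]
  have e2 : Real.exp (-2 * Real.eulerMascheroniConstant) * (Real.log z) ^ (-(2 : ℝ)) *
      Real.exp (50 / Real.log z) =
      Real.exp (-2 * (Real.log (Real.log z) + Real.eulerMascheroniConstant) + 50 / Real.log z) := by
    rw [Real.rpow_neg hlogz.le, ← Real.exp_log (Real.rpow_pos_of_pos hlogz 2),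
      Real.log_rpow hlogz, ← Real.exp_neg, ← Real.exp_add, ← Real.exp_add]
    congr 1; ring
  rw [e1, e2, Real.exp_le_exp]
  have e50 : (50 : ℝ) / Real.log z = 2 * (25 / Real.log z) := by ring
  linarith

end PairProducts

/-! ## Primes in dyadic blocks (prime number theorem) -/

namespace PairProducts

/-- The number of primes in `[a, b)` is `π'(b) − π'(a)` (`π'(n) = #{p < n}`). [folklore] -/
theorem card_Ico_filter_prime (a b : ℕ) (hab : a ≤ b) :
    #((Ico a b).filter Nat.Prime) = #(Nat.primesBelow b) - #(Nat.primesBelow a) := by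
  have hsplit : Nat.primesBelow b = Nat.primesBelow a ∪ (Ico a b).filter Nat.Prime := by
    rw [Nat.primesBelow, Nat.primesBelow, range_eq_Ico, range_eq_Ico, ← filter_union,
      Ico_union_Ico_eq_Ico (Nat.zero_le a) hab]
  have hdisj : Disjoint (Nat.primesBelow a) ((Ico a b).filter Nat.Prime) := by
    rw [Nat.primesBelow, range_eq_Ico]
    exact disjoint_filter_filter (Ico_disjoint_Ico_consecutive 0 a b)
  rw [hsplit, card_union_of_disjoint hdisj]
  omega

/-- `2^m` is not prime for `m ≥ 2`. [folklore] -/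
theorem not_prime_two_pow {m : ℕ} (hm : 2 ≤ m) : ¬ (2 ^ m).Prime := by
  intro hp
  rcases hp.eq_one_or_self_of_dvd 2 (dvd_pow_self 2 (by omega)) with h | h
  · omega
  · have : 2 ^ 2 ≤ 2 ^ m := Nat.pow_le_pow_right (by norm_num) hm
    omega

/-- `#{p < 2^m} = π(2^m)` for `m ≥ 2`. [folklore] -/
theorem card_primesBelow_two_pow {m : ℕ} (hm : 2 ≤ m) :
    #(Nat.primesBelow (2 ^ m)) = Nat.primeCounting (2 ^ m) := by
  rw [Nat.primeCounting, ← Nat.primesBelow_card_eq_primeCounting', Nat.primesBelow, Nat.primesBelow,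
    range_add_one, filter_insert, if_neg (not_prime_two_pow hm)]

/-- **Prime number theorem along the powers of `2`**: for every `c > 0`, eventually in `k`,
`|π(2^k) − 2^k/(k log 2)| ≤ c · 2^k/(k log 2)`. [cite: MontgomeryVaughan2007, §8.1 eq. (8.1), p. 244] -/
theorem eventually_abs_primeCounting_two_pow_sub_le {c : ℝ} (hc : 0 < c) :
    ∀ᶠ k : ℕ in atTop, |(Nat.primeCounting (2 ^ k) : ℝ) - 2 ^ k / (k * Real.log 2)| ≤
      c * (2 ^ k / (k * Real.log 2)) := by
  have hπ := (Literature.NumberTheory.LFunctions.primeCounting_isEquivalent_holds).isLittleO.def hc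
  have h2 : Tendsto (fun k : ℕ => (2 : ℝ) ^ k) atTop atTop := tendsto_pow_atTop_atTop_of_one_lt one_lt_two
  have hev := h2.eventually hπ
  filter_upwards [hev, eventually_ge_atTop 1] with k hk hk1
  have hfloor : ⌊(2 : ℝ) ^ k⌋₊ = 2 ^ k := by
    rw [show ((2 : ℝ) ^ k) = ((2 ^ k : ℕ) : ℝ) by push_cast; ring, Nat.floor_natCast]
  have hlog : Real.log ((2 : ℝ) ^ k) = k * Real.log 2 := by rw [Real.log_pow]
  simp only [Pi.sub_apply, hfloor, hlog, Real.norm_eq_abs] at hk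
  have hpos : 0 ≤ (2 : ℝ) ^ k / (k * Real.log 2) := by
    have := Real.log_pos one_lt_two; positivity
  rwa [abs_of_nonneg hpos] at hk

/-- **Primes in dyadic blocks**: for every `η > 0`, eventually in `k`, the block `[2^k, 2^{k+1})`
contains at least `(1 − η) 2^k/(k log 2)` primes (prime number theorem: `π(2^{k+1}) − π(2^k) =
(2 − 1 + o(1)) 2^k/(k log 2)`). [cite: MontgomeryVaughan2007, §8.1 eq. (8.1), p. 244] -/
theorem eventually_card_block_primes_ge {η : ℝ} (hη : 0 < η) :
    ∀ᶠ k : ℕ in atTop,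
      (1 - η) * (2 ^ k / (k * Real.log 2)) ≤ #((Ico (2 ^ k) (2 ^ (k + 1))).filter Nat.Prime) := by
  set c := η / 5 with hc
  have hc0 : 0 < c := by positivity
  have h0 := eventually_abs_primeCounting_two_pow_sub_le hc0
  have h1 : ∀ᶠ k : ℕ in atTop, |(Nat.primeCounting (2 ^ (k + 1)) : ℝ) -
      2 ^ (k + 1) / ((k + 1 : ℕ) * Real.log 2)| ≤ c * (2 ^ (k + 1) / ((k + 1 : ℕ) * Real.log 2)) :=
    (tendsto_add_atTop_nat 1).eventually h0
  filter_upwards [h0, h1, eventually_ge_atTop 2, eventually_ge_atTop ⌈1 / c⌉₊] with k hk0 hk1 hk2 hkc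
  have hL : 0 < Real.log 2 := Real.log_pos one_lt_two
  have hk : (0 : ℝ) < k := by exact_mod_cast (show 0 < k by omega)
  have hkc' : 1 ≤ c * k := by
    have : (⌈1 / c⌉₊ : ℝ) ≤ k := by exact_mod_cast hkc
    have h' : 1 / c ≤ k := (Nat.le_ceil _).trans this
    rwa [div_le_iff₀ hc0, mul_comm] at h'
  rw [card_Ico_filter_prime _ _ (Nat.pow_le_pow_right (by norm_num) (Nat.le_succ k)),
    card_primesBelow_two_pow (by omega), card_primesBelow_two_pow hk2,
    Nat.cast_sub (Nat.monotone_primeCounting (Nat.pow_le_pow_right (by norm_num) (Nat.le_succ k)))]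
  rw [abs_le] at hk0 hk1
  push_cast at hk1
  -- `π(2^{k+1}) ≥ (1 − c) 2^{k+1}/((k+1) L)`, `π(2^k) ≤ (1 + c) 2^k/(k L)`
  set A := (2 : ℝ) ^ k / (k * Real.log 2) with hA
  set B := (2 : ℝ) ^ (k + 1) / ((k + 1) * Real.log 2) with hB
  have hP1 : (1 - c) * B ≤ (Nat.primeCounting (2 ^ (k + 1)) : ℝ) := by linarith [hk1.1]
  have hP0 : (Nat.primeCounting (2 ^ k) : ℝ) ≤ (1 + c) * A := by linarith [hk0.2]
  -- `B = 2k/(k+1) A`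
  have hBA : B = 2 * k / (k + 1) * A := by
    rw [hA, hB, pow_succ]; field_simp
  have hApos : 0 < A := by rw [hA]; positivity
  -- it suffices that `(1 − η) ≤ (1 − c) 2k/(k+1) − (1 + c)`
  have key : (1 - η) * A ≤ (1 - c) * B - (1 + c) * A := by
    rw [hBA, show (1 - c) * (2 * k / (k + 1) * A) - (1 + c) * A =
      ((1 - c) * (2 * k / (k + 1)) - (1 + c)) * A by ring]
    refine mul_le_mul_of_nonneg_right ?_ hApos.le
    rw [hc] at hkc' ⊢
    have hk1' : (0 : ℝ) < k + 1 := by linarith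
    rw [le_sub_iff_add_le, show (1 - η / 5) * (2 * k / (k + 1)) = ((1 - η / 5) * (2 * k)) / (k + 1) by
      ring, le_div_iff₀ hk1']
    nlinarith
  linarith

end PairProducts

/-! ### The refutation -/

namespace PairProducts

open Filter Finset

/-- `(16^J)^{1/4} = 2^J`. [folklore] -/
theorem sixteen_pow_rpow_quarter (J : ℕ) : ((16 : ℝ) ^ J) ^ ((1 : ℝ) / 2 - 1 / 4) = (2 : ℝ) ^ J := by
  rw [show ((16 : ℝ) ^ J) = ((2 : ℝ) ^ J) ^ 4 by rw [← pow_mul, mul_comm, pow_mul]; norm_num,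
    show (1 : ℝ) / 2 - 1 / 4 = ((4 : ℕ) : ℝ)⁻¹ by norm_num]
  exact Real.pow_rpow_inv_natCast (by positivity) (by norm_num)

/-- `(1/2) log(16^J)/log(2^J) = 2` for `J ≥ 1`. [folklore] -/
theorem half_mul_log_sixteen_pow_div (J : ℕ) (hJ : 1 ≤ J) :
    1 / 2 * Real.log ((16 : ℝ) ^ J) / Real.log ((2 : ℝ) ^ J) = 2 := by
  have hL : 0 < Real.log 2 := Real.log_pos one_lt_two
  have hJ0 : (0 : ℝ) < J := by exact_mod_cast hJ
  rw [Real.log_pow, Real.log_pow, show (16 : ℝ) = 2 ^ 4 by norm_num, Real.log_pow]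
  field_simp
  ring

end PairProducts

namespace SieveSequence

open Filter Finset PairProducts

/-- **The least-`β` form of the `β`-sieve upper bound is FALSE.** The negated statement — the
body of the former named fact `SieveSequence.jurkat_richert_upper` of `SieveFunctions.lean`, retired
2026-08-15 and reproduced here verbatim — asserts, for EVERY `κ ≥ 1/2`, every `θ > 0` and every
sifted sequence with density in `Ω(κ, L)`, level of distribution `x^θ` and `X(x) ≥ 0` eventually,
the upper bound `S(𝒜, z; x) ≤ X V(z) (upperSieveFun κ (θ log x / log z) + ε)` for all large `x` and
`2 ≤ z ≤ x^{θ − δ}`, with `upperSieveFun κ` the `F` of the LEAST admissible `β` (`IsBetaSieveData`),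
not Iwaniec's `F_κ` (greatest `β`; see the ERRATUM there, the faithful statement
`SieveSequence.Iwaniec1980_upper`, and `SieveFunctionsProofs.siftingLimit_three_halves_lt`).
For `κ = 2` the least admissible `β` is
`< 1.393` (`siftingLimit_two_lt`), whence `upperSieveFun 2 2 ≤ 0.4703` (`upperSieveFun_two_two_le`),
while for the pair-product sequence (`PairProducts.pairProducts`: dimension `Ω(2, L)` by Mertens'
theorem, level `1/2`) at `x = 16^J`, `z = 2^J` (`s = 2`) the prime number theorem gives
`S ≥ (0.95)² (16^J − 4^J)/(12 J² log² 2)` against `X V(z) (0.4703 + 0.01) ≤ (16^J + 2)/3 ·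
e^{−2γ} e^{50/(J log 2)} (J log 2)⁻² · 0.4803`; as `e^{−2γ} < e^{−1} < 0.3679`, this is
`0.0744 > 0.0617` for large `J`. (The true asymptotic ratio `S/(X V)` is `e^{2γ}/4 = 0.79…`;
Iwaniec's `F_2(2) = A_2/4 = 10.87…` is a valid upper bound for it, the least-`β` value `0.47…`
is not.) [folklore] -/
theorem not_jurkat_richert_upper :
    ¬ ∀ (A : SieveSequence) {κ L θ : ℝ} (_hκ : 1 / 2 ≤ κ) (_hθ : 0 < θ)
        (_hdim : HasIwaniecDimension A.density κ L) (_hlevel : HasLevelOfDistribution A θ)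
        (_hsize : ∀ᶠ x : ℝ in atTop, 0 ≤ A.size x),
        ∀ ε δ : ℝ, 0 < ε → 0 < δ → ∀ᶠ x : ℝ in atTop, ∀ z : ℝ, 2 ≤ z → z ≤ x ^ (θ - δ) →
          A.sifted x (primesProdBelow z) ≤
            A.size x * A.densityProduct (primesProdBelow z) *
              (upperSieveFun κ (θ * Real.log x / Real.log z) + ε) := by
  intro h
  -- the hypotheses of the fact for the pair-product sequence, `κ = 2`, `θ = 1/2`
  have hdim : HasIwaniecDimension pairProducts.density 2 (100 * Real.exp (100 / Real.log 2)) :=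
    hasIwaniecDimension_two fun p hp => by rw [pairProducts_density, density_prime hp]
  have hsize : ∀ᶠ x : ℝ in atTop, 0 ≤ pairProducts.size x :=
    Eventually.of_forall fun x => by rw [pairProducts_size]; exact Nat.cast_nonneg _
  have hmain := h pairProducts (by norm_num : (1 : ℝ) / 2 ≤ 2) (by norm_num : (0 : ℝ) < 1 / 2) hdim
    hasLevelOfDistribution_pairProducts hsize (1 / 100) (1 / 4) (by norm_num) (by norm_num)
  -- pull back along `x = 16^J`
  have h16 : Tendsto (fun J : ℕ => (16 : ℝ) ^ J) atTop atTop :=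
    tendsto_pow_atTop_atTop_of_one_lt (by norm_num)
  have hJev := h16.eventually hmain
  -- the prime number theorem in the blocks, `η = 1/20`
  obtain ⟨K₀, hK₀⟩ := eventually_atTop.mp (eventually_card_block_primes_ge (η := 1 / 20) (by norm_num))
  obtain ⟨J, hJ, hJK, hJ6⟩ := (hJev.and ((eventually_ge_atTop K₀).and (eventually_ge_atTop 6000))).exists
  -- notation
  have hL1 := Real.log_two_gt_d9
  have hL2 := Real.log_two_lt_d9
  set L := Real.log 2 with hL
  have hL0 : 0 < L := by linarith
  have hJ1 : 1 ≤ J := by omega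
  have hJr : (6000 : ℝ) ≤ J := by exact_mod_cast hJ6
  have hJ0 : (0 : ℝ) < J := by linarith
  set W : ℝ := (16 : ℝ) ^ J with hW
  set U : ℝ := (4 : ℝ) ^ J with hU
  have hWU : W = U * U := by rw [hW, hU, ← mul_pow]; norm_num
  have hU100 : 256 ≤ U := by
    rw [hU]
    calc (256 : ℝ) = 4 ^ 4 := by norm_num
      _ ≤ 4 ^ J := pow_le_pow_right₀ (by norm_num) (by omega)
  have hW0 : 0 < W := by positivity
  -- (1) the sieve "bound" at `x = 16^J`, `z = 2^J`
  have hz2 : (2 : ℝ) ≤ (2 : ℝ) ^ J := by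
    calc (2 : ℝ) = 2 ^ 1 := by norm_num
      _ ≤ 2 ^ J := pow_le_pow_right₀ one_le_two hJ1
  have hup := hJ ((2 : ℝ) ^ J) hz2 (by rw [sixteen_pow_rpow_quarter])
  rw [half_mul_log_sixteen_pow_div J hJ1, pairProducts_densityProduct,
    show ⌈(2 : ℝ) ^ J⌉₊ = 2 ^ J by
      rw [show ((2 : ℝ) ^ J) = ((2 ^ J : ℕ) : ℝ) by push_cast; ring, Nat.ceil_natCast]] at hup
  -- (2) the ingredients
  have hF : upperSieveFun 2 2 + 1 / 100 ≤ 4803 / 10000 := by linarith [upperSieveFun_two_two_le]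
  have hX : pairProducts.size ((16 : ℝ) ^ J) ≤ (W + 2) / 3 := size_sixteen_pow_le J
  have hX0 : 0 ≤ pairProducts.size ((16 : ℝ) ^ J) := by rw [pairProducts_size]; exact Nat.cast_nonneg _
  have hV : ∏ p ∈ Nat.primesBelow (2 ^ J), (1 - (p : ℝ)⁻¹) ^ 2 ≤
      Real.exp (-2 * Real.eulerMascheroniConstant) * (Real.log ((2 : ℝ) ^ J)) ^ (-(2 : ℝ)) *
        Real.exp (50 / Real.log ((2 : ℝ) ^ J)) := by
    have := prod_one_sub_inv_sq_le hz2
    rwa [show ⌈(2 : ℝ) ^ J⌉₊ = 2 ^ J by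
      rw [show ((2 : ℝ) ^ J) = ((2 ^ J : ℕ) : ℝ) by push_cast; ring, Nat.ceil_natCast]] at this
  have hV0 : 0 ≤ ∏ p ∈ Nat.primesBelow (2 ^ J), (1 - (p : ℝ)⁻¹) ^ 2 :=
    prod_nonneg fun p _ => sq_nonneg _
  have hlog2J : Real.log ((2 : ℝ) ^ J) = J * L := by rw [Real.log_pow]
  rw [hlog2J] at hV
  -- numerical bounds: `e^{-2γ} < 0.3679`, `e^{50/(J L)} ≤ 1.0366`
  have hE : Real.exp (-2 * Real.eulerMascheroniConstant) ≤ 3679 / 10000 := by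
    have hγ := Real.one_half_lt_eulerMascheroniConstant
    have he := Real.exp_one_gt_d9
    calc Real.exp (-2 * Real.eulerMascheroniConstant) ≤ Real.exp (-1) :=
          Real.exp_le_exp.mpr (by linarith)
      _ = (Real.exp 1)⁻¹ := by rw [Real.exp_neg]
      _ ≤ (2.7182818283 : ℝ)⁻¹ := by gcongr
      _ ≤ 3679 / 10000 := by norm_num
  have hT : Real.exp (50 / (J * L)) ≤ 10366 / 10000 := by
    set t := 50 / (J * L) with ht
    have ht0 : 0 ≤ t := by positivity
    have ht1 : t ≤ 122 / 10000 := by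
      rw [ht, div_le_iff₀ (by positivity)]; nlinarith
    have he := Real.exp_one_lt_d9
    calc Real.exp t ≤ 1 + t * Real.exp t := exp_le_one_add_mul_exp t
      _ ≤ 1 + t * Real.exp 1 := by gcongr; linarith
      _ ≤ 1 + 122 / 10000 * 2.7182818286 := by gcongr
      _ ≤ 10366 / 10000 := by norm_num
  -- (3) the upper side: `S ≤ 0.0617 · W/(J² L²)`
  set Q : ℝ := W / ((J : ℝ) ^ 2 * L ^ 2) with hQ
  have hQ0 : 0 < Q := by positivity
  have hrpow : ((J : ℝ) * L) ^ (-(2 : ℝ)) = 1 / ((J : ℝ) ^ 2 * L ^ 2) := by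
    rw [Real.rpow_neg (by positivity), Real.rpow_two, mul_pow, one_div]
  rw [hrpow] at hV
  have hupper : pairProducts.sifted ((16 : ℝ) ^ J) (primesProdBelow ((2 : ℝ) ^ J)) ≤ 617 / 10000 * Q := by
    refine hup.trans ?_
    calc pairProducts.size ((16 : ℝ) ^ J) * (∏ p ∈ Nat.primesBelow (2 ^ J), (1 - (p : ℝ)⁻¹) ^ 2) *
          (upperSieveFun 2 2 + 1 / 100)
        ≤ ((W + 2) / 3) * (3679 / 10000 * (1 / ((J : ℝ) ^ 2 * L ^ 2)) * (10366 / 10000)) *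
            (4803 / 10000) := by
          rcases le_or_gt 0 (upperSieveFun 2 2 + 1 / 100) with hF0 | hF0
          · have hV' : ∏ p ∈ Nat.primesBelow (2 ^ J), (1 - (p : ℝ)⁻¹) ^ 2 ≤
                3679 / 10000 * (1 / ((J : ℝ) ^ 2 * L ^ 2)) * (10366 / 10000) := by
              refine hV.trans ?_
              gcongr
            gcongr
          · -- a negative last factor makes the product nonpositive
            have : pairProducts.size ((16 : ℝ) ^ J) *
                (∏ p ∈ Nat.primesBelow (2 ^ J), (1 - (p : ℝ)⁻¹) ^ 2) *
                (upperSieveFun 2 2 + 1 / 100) ≤ 0 :=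
              mul_nonpos_of_nonneg_of_nonpos (mul_nonneg hX0 hV0) hF0.le
            refine this.trans (by positivity)
      _ ≤ ((101 / 100 * W) / 3) * (3679 / 10000 * (1 / ((J : ℝ) ^ 2 * L ^ 2)) * (10366 / 10000)) *
            (4803 / 10000) := by gcongr; nlinarith
      _ = (101 / 100 / 3 * (3679 / 10000) * (10366 / 10000) * (4803 / 10000)) * Q := by
          rw [hQ]; ring
      _ ≤ 617 / 10000 * Q := by gcongr; norm_num
  -- (4) the lower side: `S ≥ (19/20)² (W − U)/(12 J² L²) ≥ 0.0744 · Q`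
  have hlower : 744 / 10000 * Q ≤ pairProducts.sifted ((16 : ℝ) ^ J) (primesProdBelow ((2 : ℝ) ^ J)) := by
    refine le_trans ?_ (sum_sq_card_primes_le_sifted J)
    -- each block `J ≤ k < 2J` has at least `(19/20) 2^k/(k L) ≥ 0` primes
    have hterm : ∀ k ∈ Finset.Ico J (2 * J),
        (19 / 20) ^ 2 * (4 : ℝ) ^ k / (4 * (J : ℝ) ^ 2 * L ^ 2) ≤
          ((#((block k).filter Nat.Prime) : ℝ)) ^ 2 := by
      intro k hk
      rw [Finset.mem_Ico] at hk
      have hkK : K₀ ≤ k := le_trans hJK hk.1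
      have hb := hK₀ k hkK
      have hk0 : (0 : ℝ) < k := by exact_mod_cast (show 0 < k by omega)
      have hk2J : (k : ℝ) ≤ 2 * J := by exact_mod_cast (show k ≤ 2 * J by omega)
      have hm0 : 0 ≤ (1 - 1 / 20) * ((2 : ℝ) ^ k / (k * Real.log 2)) := by positivity
      calc (19 / 20) ^ 2 * (4 : ℝ) ^ k / (4 * (J : ℝ) ^ 2 * L ^ 2)
          = ((1 - 1 / 20) * ((2 : ℝ) ^ k / (2 * J * L))) ^ 2 := by
            rw [show (4 : ℝ) ^ k = ((2 : ℝ) ^ k) ^ 2 by rw [← pow_mul, mul_comm, pow_mul]; norm_num]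
            field_simp
            norm_num
        _ ≤ ((1 - 1 / 20) * ((2 : ℝ) ^ k / (k * Real.log 2))) ^ 2 := by
            have hdiv : (2 : ℝ) ^ k / (2 * J * L) ≤ 2 ^ k / (k * Real.log 2) := by
              rw [← hL]
              exact div_le_div_of_nonneg_left (by positivity) (by positivity) (by nlinarith)
            exact pow_le_pow_left₀ (by positivity) (mul_le_mul_of_nonneg_left hdiv (by norm_num)) 2
        _ ≤ ((#((block k).filter Nat.Prime) : ℝ)) ^ 2 := by
            exact pow_le_pow_left₀ hm0 hb 2
    have hgeom : ∑ k ∈ Finset.Ico J (2 * J), (4 : ℝ) ^ k = (W - U) / 3 := by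
      rw [geom_sum_Ico (by norm_num) (by omega), hW, hU, pow_mul]
      norm_num
    have hWU99 : 99 / 100 * W ≤ W - U := by rw [hWU]; nlinarith
    have hJL : (0 : ℝ) < (J : ℝ) ^ 2 * L ^ 2 := by positivity
    calc 744 / 10000 * Q ≤ (19 / 20) ^ 2 / 12 * (99 / 100 * W / ((J : ℝ) ^ 2 * L ^ 2)) := by
          rw [hQ, mul_div_assoc]
          nlinarith [div_pos hW0 hJL]
      _ ≤ (19 / 20) ^ 2 / 12 * ((W - U) / ((J : ℝ) ^ 2 * L ^ 2)) := by gcongr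
      _ = (19 / 20) ^ 2 * ((W - U) / 3) / (4 * (J : ℝ) ^ 2 * L ^ 2) := by
          field_simp
          ring
      _ = ∑ k ∈ Finset.Ico J (2 * J), (19 / 20) ^ 2 * (4 : ℝ) ^ k / (4 * (J : ℝ) ^ 2 * L ^ 2) := by
          rw [← hgeom, ← Finset.sum_div, ← Finset.mul_sum]
      _ ≤ ∑ k ∈ Finset.Ico J (2 * J), ((#((block k).filter Nat.Prime) : ℝ)) ^ 2 :=
          Finset.sum_le_sum hterm
  linarith

end SieveSequence

/-! ## The least-`β` data of dimension `2` from below: `β > 1.39`, `A ≥ 1.068`, `f(2) ≥ 1.30` -/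

/-- `∫_a^b (1 + x)⁻² dx = 1/(1 + a) − 1/(1 + b)` for `−1 < a ≤ b`. [folklore] -/
theorem integral_inv_one_add_pow_two {a b : ℝ} (ha : -1 < a) (hab : a ≤ b) :
    ∫ x in a..b, ((1 + x) ^ 2)⁻¹ = 1 / (1 + a) - 1 / (1 + b) := by
  have hderiv : ∀ x ∈ Set.uIcc a b, HasDerivAt (fun x : ℝ => -(1 + x)⁻¹) (((1 + x) ^ 2)⁻¹) x := by
    intro x hx
    rw [Set.uIcc_of_le hab] at hx
    have hx0 : (1 + x) ≠ 0 := by linarith [hx.1]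
    have h1 : HasDerivAt (fun x : ℝ => 1 + x) 1 x := (hasDerivAt_id x).const_add 1
    have h2 : HasDerivAt (fun y : ℝ => -(1 + y)⁻¹) (-(-1 / (1 + x) ^ 2)) x := (h1.fun_inv hx0).fun_neg
    refine h2.congr_deriv ?_
    field_simp
  have hint : IntervalIntegrable (fun x : ℝ => ((1 + x) ^ 2)⁻¹) volume a b := by
    refine ContinuousOn.intervalIntegrable ?_
    rw [Set.uIcc_of_le hab]
    refine ContinuousOn.inv₀ (by fun_prop) fun x hx => ?_
    have : 0 < 1 + x := by linarith [hx.1]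
    positivity
  rw [integral_eq_sub_of_hasDerivAt hderiv hint]
  have : (1 + a) ≠ 0 := by linarith
  have : (1 + b) ≠ 0 := by linarith
  field_simp
  ring

/-- The integrand of `p_2` is at most `e^{−sx} (1 + x)⁻²` (`Ein x ≥ log (1 + x)`). [folklore] -/
theorem rosserAdjointP_two_integrand_le (s : ℝ) {x : ℝ} (hx : 0 ≤ x) :
    Real.exp (-(s * x) - 2 * ein x) ≤ Real.exp (-(s * x)) * ((1 + x) ^ 2)⁻¹ := by
  have h1 : Real.log (1 + x) ≤ ein x := log_one_add_le_ein hx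
  have hpos : 0 < 1 + x := by linarith
  rw [show -(s * x) - 2 * ein x = -(s * x) + (-(2 * ein x)) by ring, Real.exp_add]
  refine mul_le_mul_of_nonneg_left ?_ (Real.exp_pos _).le
  calc Real.exp (-(2 * ein x)) ≤ Real.exp (-(2 * Real.log (1 + x))) :=
        Real.exp_le_exp.mpr (by linarith)
    _ = ((1 + x) ^ 2)⁻¹ := by
        have e : 2 * Real.log (1 + x) = Real.log ((1 + x) ^ 2) := by
          rw [Real.log_pow]; norm_num
        rw [Real.exp_neg, e, Real.exp_log (by positivity)]

/-- **`p_2(u) ≤ 0.73` for `u ≥ 0.39`** (`p_2` decreasing; `p_2(0.39) ≤ ∫_0^1 (1+x)⁻² +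
e^{−0.39} ∫_1^3 (1+x)⁻² + (1/16) ∫_3^∞ e^{−0.39 x} = 1/2 + e^{−0.39}/4 + e^{−1.17}/6.24 ≤ 0.727`).
[folklore] -/
theorem rosserAdjointP_two_le {u : ℝ} (hu : 39 / 100 ≤ u) : rosserAdjointP 2 u ≤ 73 / 100 := by
  have hmono : rosserAdjointP 2 u ≤ rosserAdjointP 2 (39 / 100) :=
    rosserAdjointP.antitoneOn (by norm_num) (show (0 : ℝ) < 39 / 100 by norm_num)
      (show (0 : ℝ) < u by linarith) hu
  refine hmono.trans ?_
  set a : ℝ := 39 / 100 with ha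
  set g : ℝ → ℝ := fun x => Real.exp (-(a * x) - 2 * ein x) with hg
  have hgc : Continuous g := rosserAdjointP.continuous_integrand 2 a
  have hgi : IntegrableOn g (Set.Ioi 0) := rosserAdjointP.integrableOn_integrand (by norm_num) (by norm_num)
  have hg0 : ∀ x, 0 ≤ g x := fun x => (Real.exp_pos _).le
  rw [rosserAdjointP_def]
  change ∫ x in Set.Ioi 0, g x ≤ 73 / 100
  -- split at `3`
  have hsplit : ∫ x in Set.Ioi 0, g x = (∫ x in Set.Ioc 0 3, g x) + ∫ x in Set.Ioi 3, g x := by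
    rw [← setIntegral_union (Set.Ioc_disjoint_Ioi le_rfl) measurableSet_Ioi
      (hgi.mono_set Set.Ioc_subset_Ioi_self) (hgi.mono_set (Set.Ioi_subset_Ioi (by norm_num))),
      Set.Ioc_union_Ioi_eq_Ioi (by norm_num)]
  -- numerical exponential bounds
  have hea : Real.exp (-a) ≤ 6822 / 10000 := by
    have h := Real.quadratic_le_exp_of_nonneg (show (0 : ℝ) ≤ a by norm_num)
    rw [Real.exp_neg, inv_le_comm₀ (Real.exp_pos _) (by norm_num)]
    refine le_trans ?_ h
    rw [ha]; norm_num
  have he3a : Real.exp (-(a * 3)) ≤ 3504 / 10000 := by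
    have h := Real.quadratic_le_exp_of_nonneg (show (0 : ℝ) ≤ a * 3 by norm_num)
    rw [Real.exp_neg, inv_le_comm₀ (Real.exp_pos _) (by norm_num)]
    refine le_trans ?_ h
    rw [ha]; norm_num
  -- the tail `∫_3^∞ g ≤ (1/16) ∫_3^∞ e^{−a x}`
  have htail : ∫ x in Set.Ioi 3, g x ≤ 562 / 10000 := by
    have hexp : IntegrableOn (fun x : ℝ => Real.exp (-a * x)) (Set.Ioi 3) :=
      integrableOn_exp_mul_Ioi (by norm_num) 3
    calc ∫ x in Set.Ioi 3, g x ≤ ∫ x in Set.Ioi 3, (1 / 16) * Real.exp (-a * x) := by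
          refine setIntegral_mono_on (hgi.mono_set (Set.Ioi_subset_Ioi (by norm_num)))
            (hexp.const_mul _) measurableSet_Ioi fun x hx => ?_
          have hx3 : 3 < x := hx
          calc g x ≤ Real.exp (-(a * x)) * ((1 + x) ^ 2)⁻¹ :=
                rosserAdjointP_two_integrand_le a (by linarith)
            _ ≤ Real.exp (-(a * x)) * (1 / 16) := by
                gcongr
                rw [inv_le_comm₀ (by positivity) (by norm_num)]
                nlinarith
            _ = 1 / 16 * Real.exp (-a * x) := by ring_nf
      _ = 1 / 16 * (Real.exp (-(a * 3)) / a) := by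
          rw [MeasureTheory.integral_const_mul, integral_exp_mul_Ioi (by norm_num) 3]
          congr 1
          rw [show -a * 3 = -(a * 3) by ring]
          field_simp
      _ ≤ 1 / 16 * ((3504 / 10000) / a) := by gcongr
      _ ≤ 562 / 10000 := by rw [ha]; norm_num
  -- the head `∫_0^3 g ≤ ∫_0^1 (1+x)⁻² + e^{−a} ∫_1^3 (1+x)⁻²`
  have hhead : ∫ x in Set.Ioc 0 3, g x ≤ 6706 / 10000 := by
    rw [← intervalIntegral.integral_of_le (by norm_num : (0 : ℝ) ≤ 3),
      ← integral_add_adjacent_intervals (b := 1) (hgc.intervalIntegrable 0 1)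
        (hgc.intervalIntegrable 1 3)]
    have hI1 := integral_inv_one_add_pow_two (a := 0) (b := 1) (by norm_num) (by norm_num)
    have hI2 := integral_inv_one_add_pow_two (a := 1) (b := 3) (by norm_num) (by norm_num)
    have hc1 : ContinuousOn (fun x : ℝ => ((1 + x) ^ 2)⁻¹) (Set.Icc 0 3) := by
      refine ContinuousOn.inv₀ (by fun_prop) fun x hx => ?_
      have : 0 < 1 + x := by linarith [hx.1]
      positivity
    have h1 : ∫ x in (0 : ℝ)..1, g x ≤ ∫ x in (0 : ℝ)..1, ((1 + x) ^ 2)⁻¹ := by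
      refine intervalIntegral.integral_mono_on (by norm_num) (hgc.intervalIntegrable 0 1)
        ((hc1.mono (Set.Icc_subset_Icc le_rfl (by norm_num))).intervalIntegrable_of_Icc (by norm_num))
        fun x hx => ?_
      calc g x ≤ Real.exp (-(a * x)) * ((1 + x) ^ 2)⁻¹ := rosserAdjointP_two_integrand_le a hx.1
        _ ≤ 1 * ((1 + x) ^ 2)⁻¹ := by
            gcongr
            rw [Real.exp_le_one_iff]
            have : 0 ≤ a * x := by rw [ha]; nlinarith [hx.1]
            linarith
        _ = ((1 + x) ^ 2)⁻¹ := one_mul _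
    have h2 : ∫ x in (1 : ℝ)..3, g x ≤ ∫ x in (1 : ℝ)..3, Real.exp (-a) * ((1 + x) ^ 2)⁻¹ := by
      refine intervalIntegral.integral_mono_on (by norm_num) (hgc.intervalIntegrable 1 3)
        (((hc1.mono (Set.Icc_subset_Icc (by norm_num) le_rfl)).intervalIntegrable_of_Icc
          (by norm_num)).const_mul _) fun x hx => ?_
      calc g x ≤ Real.exp (-(a * x)) * ((1 + x) ^ 2)⁻¹ :=
            rosserAdjointP_two_integrand_le a (by linarith [hx.1])
        _ ≤ Real.exp (-a) * ((1 + x) ^ 2)⁻¹ := by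
            gcongr
            have : 0 ≤ a := by rw [ha]; norm_num
            nlinarith [hx.1]
    rw [intervalIntegral.integral_const_mul] at h2
    rw [hI1] at h1
    rw [hI2] at h2
    norm_num at h1 h2
    nlinarith [hea, h1, h2]
  rw [hsplit]
  linarith


/-- **`siftingLimit 2 > 1.39`**: every admissible `β` of dimension `2` has `q_2(β − 1) = 0`
(`IsBetaSieveSolution.cubic_eq_zero`), and `q_2 < 0` on `(0, 0.39]`. [folklore] -/
theorem siftingLimit_two_gt : 139 / 100 < siftingLimit 2 := by
  have h := isBetaSieveSolution_upperSieveFun_lowerSieveFun exists_isBetaSieveData_holds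
    (by norm_num : (1 : ℝ) / 2 ≤ 2)
  have hβ := h.one_lt (by norm_num)
  have hq := h.cubic_eq_zero
  set u := siftingLimit 2 - 1 with hu
  have hu0 : 0 < u := by rw [hu]; linarith
  by_contra hle
  have hule : u ≤ 39 / 100 := by rw [hu]; linarith
  -- `q(u) = q(0.39) + (u − 0.39)(u² − 5.61 u + 6.8121)` with `q(0.39) < 0`
  have key : u ^ 3 - 6 * u ^ 2 + 9 * u - 8 / 3 =
      ((39 / 100 : ℝ) ^ 3 - 6 * (39 / 100) ^ 2 + 9 * (39 / 100) - 8 / 3) +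
        (u - 39 / 100) * (u ^ 2 - 561 / 100 * u + 68121 / 10000) := by ring
  have hfac : 0 < u ^ 2 - 561 / 100 * u + 68121 / 10000 := by nlinarith
  have : (u - 39 / 100) * (u ^ 2 - 561 / 100 * u + 68121 / 10000) ≤ 0 :=
    mul_nonpos_of_nonpos_of_nonneg (by linarith) hfac.le
  have hneg : u ^ 3 - 6 * u ^ 2 + 9 * u - 8 / 3 < 0 := by rw [key]; norm_num at this ⊢; linarith
  exact hneg.ne hq

/-- **`A ≥ 1.068` for the least-`β` data of dimension `2`**: `A = 2u/p_2(u)` with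
`u = β − 1 ∈ (0.39, 0.393)` and `p_2(u) ≤ 0.73`. [folklore] -/
theorem betaSieveConst_two_ge : 2 * (39 / 100) / (73 / 100) ≤ betaSieveConst 2 := by
  have hβ1 := siftingLimit_two_gt
  set u := siftingLimit 2 - 1 with hu
  have hu39 : 39 / 100 ≤ u := by rw [hu]; linarith
  have hu0 : 0 < u := by linarith
  have hA : betaSieveConst 2 = 2 * u / rosserAdjointP 2 u := by
    rw [betaSieveConst_eq exists_isBetaSieveData_holds (by norm_num : (1 : ℝ) ≤ 2), hu]
    norm_num
  have hp := rosserAdjointP_two_le hu39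
  have hp0 : 0 < rosserAdjointP 2 u := rosserAdjointP.pos (by norm_num) hu0
  rw [hA, div_le_div_iff₀ (by norm_num) hp0]
  nlinarith

/-- **`lowerSieveFun 2 2 ≥ 1.30`**: integrating `(s² f)' = 2 s F(s − 1) = 2As/(s − 1)²` from
`β` (where `f = 0`) to `2` gives `4 f(2) = 2A (1/u − 1 − log u)`, `u = β − 1 ∈ (0.39, 0.393)`;
with `A ≥ 1.068` and `−log u ≥ log 2 + 1 − 2u`. (For comparison: Iwaniec's `f_2(2) = 0`, as
`2 < β_2 = 4.83`.) [folklore] -/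
theorem lowerSieveFun_two_two_ge : 13 / 10 ≤ lowerSieveFun 2 2 := by
  have h := isBetaSieveSolution_upperSieveFun_lowerSieveFun exists_isBetaSieveData_holds
    (by norm_num : (1 : ℝ) / 2 ≤ 2)
  set F := upperSieveFun 2
  set f := lowerSieveFun 2
  set β := siftingLimit 2 with hβdef
  set A := betaSieveConst 2 with hAdef
  have hβ1 : 139 / 100 < β := siftingLimit_two_gt
  have hβ2 : β < 1393 / 1000 := siftingLimit_two_lt
  have hA : 2 * (39 / 100) / (73 / 100) ≤ A := betaSieveConst_two_ge
  have hA0 : 0 < A := h.pos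
  set u := β - 1 with hu
  have hu0 : 0 < u := by linarith
  -- the derivative of `s² f` on `(β, 2]`
  set φ : ℝ → ℝ := fun s => 2 * A * s / (s - 1) ^ 2 with hφ
  have hderiv : ∀ s ∈ Set.Ioo β 2, HasDerivWithinAt (fun t : ℝ => t ^ (2 : ℝ) * f t) (φ s) (Set.Ioi s) s := by
    intro s hs
    have h1 := h.hasDerivAt_lower s hs.1
    have hs1 : s - 1 ∈ Set.Ioc 0 (β + 1) := ⟨by linarith [hs.1], by linarith [hs.2]⟩
    rw [h.upper_eq (s - 1) hs1] at h1
    have hs0 : 0 < s - 1 := by linarith [hs.1]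
    have e : (2 : ℝ) * s ^ ((2 : ℝ) - 1) * (A * (s - 1) ^ (-(2 : ℝ))) = φ s := by
      rw [show (2 : ℝ) - 1 = 1 by norm_num, Real.rpow_one, Real.rpow_neg hs0.le, Real.rpow_two, hφ]
      field_simp
    rw [e] at h1
    exact h1.hasDerivWithinAt
  have hcont : ContinuousOn (fun t : ℝ => t ^ (2 : ℝ) * f t) (Set.Icc β 2) := by
    refine ContinuousOn.mul (fun t ht => ?_) (h.continuousOn_lower.mono fun t ht => ?_)
    · exact (Real.continuousAt_rpow_const _ _ (Or.inr (by norm_num))).continuousWithinAt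
    · exact lt_of_lt_of_le (by linarith) ht.1
  have hφc : ContinuousOn φ (Set.Icc β 2) := by
    simp only [hφ]
    refine ContinuousOn.div (by fun_prop) (by fun_prop) fun s hs => ?_
    have : 0 < s - 1 := by linarith [hs.1]
    positivity
  have hint : IntervalIntegrable φ volume β 2 := hφc.intervalIntegrable_of_Icc (by linarith)
  have hFTC := integral_eq_sub_of_hasDeriv_right_of_le (by linarith) hcont hderiv hint
  -- `f β = 0`, `2^2 f 2 = 4 f 2`
  have hfβ : f β = 0 := h.lower_eq β ⟨by linarith, le_rfl⟩
  rw [hfβ, mul_zero, sub_zero, Real.rpow_two] at hFTC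
  -- evaluate `∫_β^2 φ = 2A [log(s-1) - 1/(s-1)]_β^2`
  have hanti : ∀ s ∈ Set.uIcc β 2,
      HasDerivAt (fun t : ℝ => 2 * A * (Real.log (t - 1) - (t - 1)⁻¹)) (φ s) s := by
    intro s hs
    rw [Set.uIcc_of_le (by linarith)] at hs
    have hs0 : s - 1 ≠ 0 := by linarith [hs.1]
    have h1 : HasDerivAt (fun t : ℝ => t - 1) 1 s := (hasDerivAt_id s).sub_const 1
    have h2 := ((h1.log hs0).sub (h1.fun_inv hs0)).const_mul (2 * A)
    refine h2.congr_deriv ?_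
    rw [hφ]
    field_simp
    ring
  have hval := integral_eq_sub_of_hasDerivAt hanti hint
  rw [hval] at hFTC
  norm_num at hFTC
  -- `hFTC : 2A(-1 - (log u - u⁻¹)) = 4 f 2` up to normalisation; lower bounds
  have hlog : Real.log 2 + (1 - 2 * u) ≤ -Real.log (β - 1) := by
    have h1 : 1 - (1 / (2 * u))⁻¹ ≤ Real.log (1 / (2 * u)) :=
      Real.one_sub_inv_le_log_of_pos (by positivity)
    have h2 : Real.log (1 / (2 * u)) = -Real.log (β - 1) - Real.log 2 := by
      rw [one_div, Real.log_inv, Real.log_mul (by norm_num) hu0.ne', hu]; ring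
    rw [h2] at h1
    have h3 : (1 / (2 * u))⁻¹ = 2 * u := by rw [one_div, inv_inv]
    rw [h3] at h1
    linarith
  have hl2 := Real.log_two_gt_d9
  have hinv : (1000 : ℝ) / 393 ≤ (β - 1)⁻¹ := by
    rw [div_le_iff₀ (by norm_num), ← hu]
    have : u⁻¹ * u = 1 := inv_mul_cancel₀ hu0.ne'
    nlinarith
  -- assemble: `4 f 2 = 2A((β-1)⁻¹ - 1 - log(β-1)) ≥ 2 · 1.068 · 2.4516`
  have hbr : (24516 : ℝ) / 10000 ≤ (β - 1)⁻¹ - 1 - Real.log (β - 1) := by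
    rw [← hu] at hlog ⊢
    nlinarith
  nlinarith [mul_le_mul hA hbr (by norm_num) hA0.le]

/-! ## The lower-bound companion: `¬ SieveSequence.jurkat_richert_lower` -/

namespace PairProducts

open Filter Finset

/-- **Lower bound for `V(z)`**: for `z ≥ 2`, `∏_{p<z} (1 − 1/p)² ≥ e^{−2γ} (log z)⁻² e^{−50/log z}`.
[cite: HardyWright2008, Thm 429 (§22.8)] -/
theorem prod_one_sub_inv_sq_ge {z : ℝ} (hz : 2 ≤ z) :
    Real.exp (-2 * Real.eulerMascheroniConstant) * (Real.log z) ^ (-(2 : ℝ)) *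
        Real.exp (-(50 / Real.log z)) ≤
      ∏ p ∈ Nat.primesBelow ⌈z⌉₊, (1 - (p : ℝ)⁻¹) ^ 2 := by
  have hlogz : 0 < Real.log z := Real.log_pos (by linarith)
  obtain ⟨-, h2⟩ := abs_le.mp (abs_log_mertensProd_sub_le hz)
  have hP := mertensProd_pos z
  have e1 : ∏ p ∈ Nat.primesBelow ⌈z⌉₊, (1 - (p : ℝ)⁻¹) ^ 2 = Real.exp (-2 * Real.log (mertensProd z)) := by
    have e3 : ∏ p ∈ Nat.primesBelow ⌈z⌉₊, (1 - (p : ℝ)⁻¹) ^ 2 = ((mertensProd z)⁻¹) ^ 2 := by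
      rw [mertensProd, ← Finset.prod_inv_distrib, ← Finset.prod_pow]
      exact prod_congr rfl fun p _ => by rw [inv_inv]
    have e4 : Real.log (((mertensProd z)⁻¹) ^ 2) = -2 * Real.log (mertensProd z) := by
      rw [Real.log_pow, Real.log_inv]; push_cast; ring
    rw [e3, ← e4, Real.exp_log (by positivity)]
  have e2 : Real.exp (-2 * Real.eulerMascheroniConstant) * (Real.log z) ^ (-(2 : ℝ)) *
      Real.exp (-(50 / Real.log z)) =
      Real.exp (-2 * (Real.log (Real.log z) + Real.eulerMascheroniConstant) - 50 / Real.log z) := by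
    rw [Real.rpow_neg hlogz.le, ← Real.exp_log (Real.rpow_pos_of_pos hlogz 2),
      Real.log_rpow hlogz, ← Real.exp_neg, ← Real.exp_add, ← Real.exp_add]
    congr 1; ring
  rw [e1, e2, Real.exp_le_exp]
  have e50 : (50 : ℝ) / Real.log z = 2 * (25 / Real.log z) := by ring
  linarith

/-- **`X(16^J) ≥ (16^J − 1)/3`** (the full blocks `k < 2J`). [folklore] -/
theorem size_sixteen_pow_ge (J : ℕ) :
    ((16 : ℝ) ^ J - 1) / 3 ≤ pairProducts.size ((16 : ℝ) ^ J) := by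
  rw [pairProducts_size, show ((16 : ℝ) ^ J) = ((16 ^ J : ℕ) : ℝ) by push_cast; ring,
    Nat.floor_natCast]
  have hsub : (range (2 * J)).biUnion (fun k => blockPairs k (16 ^ J)) ⊆ pairSet (16 ^ J) := by
    intro x hx
    rw [Finset.mem_biUnion] at hx
    obtain ⟨k, -, hk⟩ := hx
    exact blockPairs_subset_pairSet k _ hk
  have hdisj : ((range (2 * J) : Finset ℕ) : Set ℕ).PairwiseDisjoint
      (fun k => blockPairs k (16 ^ J)) := by
    intro k _ l _ hkl
    simp only [Function.onFun]
    rw [Finset.disjoint_left]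
    intro x hxk hxl
    exact hkl ((mem_block_iff_log.mp (mem_blockPairs.mp hxk).1).2.symm.trans
      (mem_block_iff_log.mp (mem_blockPairs.mp hxl).1).2)
  have hcard : ∀ k ∈ range (2 * J), #(blockPairs k (16 ^ J)) = 4 ^ k := by
    intro k hk
    rw [Finset.mem_range] at hk
    rw [blockPairs_eq_product, Finset.card_product, card_block, ← mul_pow]
    · norm_num
    · calc 4 ^ (k + 1) ≤ 4 ^ (2 * J) := Nat.pow_le_pow_right (by norm_num) (by omega)
        _ = 16 ^ J := by rw [pow_mul]; norm_num
  have h1 : ∑ k ∈ range (2 * J), (4 : ℝ) ^ k ≤ #(pairSet (16 ^ J)) := by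
    calc ∑ k ∈ range (2 * J), (4 : ℝ) ^ k = ∑ k ∈ range (2 * J), (#(blockPairs k (16 ^ J)) : ℝ) := by
          refine sum_congr rfl fun k hk => ?_
          rw [hcard k hk]; push_cast; ring
      _ = #((range (2 * J)).biUnion fun k => blockPairs k (16 ^ J)) := by
          rw [Finset.card_biUnion hdisj]; push_cast; rfl
      _ ≤ #(pairSet (16 ^ J)) := by exact_mod_cast Finset.card_le_card hsub
  rw [geom_sum_eq (by norm_num), pow_mul] at h1
  norm_num at h1
  push_cast
  linarith

/-- In a block `B_k` with `k < J`, only `1` is coprime to `P(2^J)`; for `J ≤ k < 2J` the elements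
of `B_k` coprime to `P(2^J)` are primes. [folklore] -/
theorem prime_of_mem_block_of_coprime {J k m : ℕ} (hk : k < 2 * J) (hm : m ∈ block k)
    (hcop : ∀ q ∈ Nat.primesBelow (2 ^ J), ¬ q ∣ m) : m = 1 ∨ (J ≤ k ∧ m.Prime) := by
  obtain ⟨h1, h2⟩ := mem_block.mp hm
  by_cases hm1 : m = 1
  · exact Or.inl hm1
  right
  have hmf : m.minFac.Prime := Nat.minFac_prime hm1
  have hmfJ : 2 ^ J ≤ m.minFac := by
    by_contra hlt
    exact hcop _ (Nat.mem_primesBelow.mpr ⟨not_le.mp hlt, hmf⟩) (Nat.minFac_dvd m)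
  have hpos : 0 < m := by have := Nat.one_le_two_pow (n := k); omega
  constructor
  · by_contra hJk
    have : 2 ^ (k + 1) ≤ 2 ^ J := Nat.pow_le_pow_right (by norm_num) (by omega)
    have := Nat.minFac_le hpos
    omega
  · by_contra hnp
    have hsq := Nat.minFac_sq_le_self hpos hnp
    have : 2 ^ J * 2 ^ J ≤ m.minFac * m.minFac := Nat.mul_le_mul hmfJ hmfJ
    have h4 : 2 ^ (k + 1) ≤ 2 ^ J * 2 ^ J := by
      rw [← pow_add]; exact Nat.pow_le_pow_right (by norm_num) (by omega)
    nlinarith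

/-- **Upper bound for the sifted sum by prime pairs**: at `x = 16^J`, `z = 2^J`,
`S(𝒜, z; x) ≤ J + 1 + ∑_{J ≤ k < 2J} (#{p ∈ B_k prime})²` (blocks `k < J` contribute at most the
pair `(1,1)` each, blocks `J ≤ k < 2J` only prime pairs, the block `2J` at most one pair, higher blocks
nothing). [folklore] -/
theorem sifted_le_sum_sq_card_primes (J : ℕ) (hJ : 1 ≤ J) :
    pairProducts.sifted ((16 : ℝ) ^ J) (primesProdBelow ((2 : ℝ) ^ J)) ≤
      J + 1 + ∑ k ∈ Finset.Ico J (2 * J), ((#((block k).filter Nat.Prime) : ℝ)) ^ 2 := by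
  rw [pairProducts_sifted, show ((16 : ℝ) ^ J) = ((16 ^ J : ℕ) : ℝ) by push_cast; ring,
    Nat.floor_natCast, card_filter_pairSet]
  have hK : Nat.log 2 (16 ^ J) = 4 * J := by
    rw [show (16 : ℕ) ^ J = 2 ^ (4 * J) by rw [pow_mul]; norm_num, Nat.log_pow (by norm_num)]
  rw [hK]
  have hz : ⌈(2 : ℝ) ^ J⌉₊ = 2 ^ J := by
    rw [show ((2 : ℝ) ^ J) = ((2 ^ J : ℕ) : ℝ) by push_cast; ring, Nat.ceil_natCast]
  -- the per-block bound
  set T : ℕ → ℕ := fun k => #{x ∈ blockPairs k (16 ^ J) |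
    (x.1 * x.2).Coprime (primesProdBelow ((2 : ℝ) ^ J))} with hT
  have hcopr : ∀ x : ℕ × ℕ, (x.1 * x.2).Coprime (primesProdBelow ((2 : ℝ) ^ J)) →
      (∀ q ∈ Nat.primesBelow (2 ^ J), ¬ q ∣ x.1) ∧ (∀ q ∈ Nat.primesBelow (2 ^ J), ¬ q ∣ x.2) := by
    intro x hx
    rw [coprime_primesProdBelow_iff, hz] at hx
    exact ⟨fun q hq hd => hx q hq (hd.mul_right _), fun q hq hd => hx q hq (hd.mul_left _)⟩
  have hsmall : ∀ k, k < J → T k ≤ 1 := by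
    intro k hk
    refine card_le_one.mpr fun x hx y hy => ?_
    simp only [Finset.mem_filter] at hx hy
    obtain ⟨hx1, hx2, -⟩ := mem_blockPairs.mp hx.1
    obtain ⟨hy1, hy2, -⟩ := mem_blockPairs.mp hy.1
    have kJ : k < 2 * J := by omega
    have ex1 := (prime_of_mem_block_of_coprime kJ hx1 (hcopr x hx.2).1).resolve_right (by omega)
    have ex2 := (prime_of_mem_block_of_coprime kJ hx2 (hcopr x hx.2).2).resolve_right (by omega)
    have ey1 := (prime_of_mem_block_of_coprime kJ hy1 (hcopr y hy.2).1).resolve_right (by omega)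
    have ey2 := (prime_of_mem_block_of_coprime kJ hy2 (hcopr y hy.2).2).resolve_right (by omega)
    exact Prod.ext (ex1.trans ey1.symm) (ex2.trans ey2.symm)
  have hmid : ∀ k, J ≤ k → k < 2 * J → T k ≤ #((block k).filter Nat.Prime) ^ 2 := by
    intro k hk1 hk2
    rw [sq, ← card_product]
    refine card_le_card fun x hx => ?_
    simp only [Finset.mem_filter] at hx
    obtain ⟨hx1, hx2, -⟩ := mem_blockPairs.mp hx.1
    have p1 := (prime_of_mem_block_of_coprime hk2 hx1 (hcopr x hx.2).1).resolve_left (by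
      intro h; have := (mem_block.mp hx1).1; rw [h] at this
      have : 2 ^ 1 ≤ 2 ^ k := Nat.pow_le_pow_right (by norm_num) (by omega); omega)
    have p2 := (prime_of_mem_block_of_coprime hk2 hx2 (hcopr x hx.2).2).resolve_left (by
      intro h; have := (mem_block.mp hx2).1; rw [h] at this
      have : 2 ^ 1 ≤ 2 ^ k := Nat.pow_le_pow_right (by norm_num) (by omega); omega)
    exact mem_product.mpr ⟨mem_filter.mpr ⟨hx1, p1.2⟩, mem_filter.mpr ⟨hx2, p2.2⟩⟩
  have htop : ∀ k, 2 * J ≤ k → T k ≤ if k = 2 * J then 1 else 0 := by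
    intro k hk
    split_ifs with h
    · subst h
      exact (card_filter_le _ _).trans (card_blockPairs_two_mul_le_one J)
    · have : blockPairs k (16 ^ J) = ∅ := blockPairs_eq_empty (by
        calc 16 ^ J = 4 ^ (2 * J) := by rw [pow_mul]; norm_num
          _ < 4 ^ k := Nat.pow_lt_pow_right (by norm_num) (by omega))
      simp [hT, this]
  -- split the range `[0, 4J] = [0, J) ∪ [J, 2J) ∪ [2J, 4J+1)`
  have hsplit : ∑ k ∈ range (4 * J + 1), (T k : ℝ) = ∑ k ∈ range J, (T k : ℝ) +
      ∑ k ∈ Finset.Ico J (2 * J), (T k : ℝ) + ∑ k ∈ Finset.Ico (2 * J) (4 * J + 1), (T k : ℝ) := by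
    rw [Finset.sum_range_add_sum_Ico _ (by omega : J ≤ 2 * J),
      Finset.sum_range_add_sum_Ico _ (by omega : 2 * J ≤ 4 * J + 1)]
  push_cast
  rw [hsplit]
  have h1 : ∑ k ∈ range J, (T k : ℝ) ≤ J := by
    calc ∑ k ∈ range J, (T k : ℝ) ≤ ∑ k ∈ range J, (1 : ℝ) :=
          sum_le_sum fun k hk => by exact_mod_cast hsmall k (mem_range.mp hk)
      _ = J := by simp
  have h2 : ∑ k ∈ Finset.Ico J (2 * J), (T k : ℝ) ≤
      ∑ k ∈ Finset.Ico J (2 * J), ((#((block k).filter Nat.Prime) : ℝ)) ^ 2 :=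
    sum_le_sum fun k hk => by
      rw [Finset.mem_Ico] at hk
      exact_mod_cast hmid k hk.1 hk.2
  have h3 : ∑ k ∈ Finset.Ico (2 * J) (4 * J + 1), (T k : ℝ) ≤ 1 := by
    calc ∑ k ∈ Finset.Ico (2 * J) (4 * J + 1), (T k : ℝ)
        ≤ ∑ k ∈ Finset.Ico (2 * J) (4 * J + 1), (if k = 2 * J then (1 : ℝ) else 0) :=
          sum_le_sum fun k hk => by
            rw [Finset.mem_Ico] at hk
            have := htop k hk.1
            split_ifs at this ⊢ <;> exact_mod_cast this
      _ = 1 := by rw [sum_ite_eq']; simp; omega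
  linarith

/-- **Primes in dyadic blocks, upper bound**: for every `η > 0`, eventually in `k`, the block
`[2^k, 2^{k+1})` contains at most `(1 + η) 2^k/(k log 2)` primes. [cite: MontgomeryVaughan2007, §8.1 eq. (8.1), p. 244] -/
theorem eventually_card_block_primes_le {η : ℝ} (hη : 0 < η) :
    ∀ᶠ k : ℕ in atTop,
      (#((Finset.Ico (2 ^ k) (2 ^ (k + 1))).filter Nat.Prime) : ℝ) ≤ (1 + η) * (2 ^ k / (k * Real.log 2)) := by
  set c := η / 3 with hc
  have hc0 : 0 < c := by positivity
  have h0 := eventually_abs_primeCounting_two_pow_sub_le hc0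
  have h1 : ∀ᶠ k : ℕ in atTop, |(Nat.primeCounting (2 ^ (k + 1)) : ℝ) -
      2 ^ (k + 1) / ((k + 1 : ℕ) * Real.log 2)| ≤ c * (2 ^ (k + 1) / ((k + 1 : ℕ) * Real.log 2)) :=
    (tendsto_add_atTop_nat 1).eventually h0
  filter_upwards [h0, h1, eventually_ge_atTop 2] with k hk0 hk1 hk2
  have hL : 0 < Real.log 2 := Real.log_pos one_lt_two
  have hk : (0 : ℝ) < k := by exact_mod_cast (show 0 < k by omega)
  rw [card_Ico_filter_prime _ _ (Nat.pow_le_pow_right (by norm_num) (Nat.le_succ k)),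
    card_primesBelow_two_pow (by omega), card_primesBelow_two_pow hk2,
    Nat.cast_sub (Nat.monotone_primeCounting (Nat.pow_le_pow_right (by norm_num) (Nat.le_succ k)))]
  rw [abs_le] at hk0 hk1
  push_cast at hk1
  set A := (2 : ℝ) ^ k / (k * Real.log 2) with hA
  set B := (2 : ℝ) ^ (k + 1) / ((k + 1) * Real.log 2) with hB
  have hP1 : (Nat.primeCounting (2 ^ (k + 1)) : ℝ) ≤ (1 + c) * B := by linarith [hk1.2]
  have hP0 : (1 - c) * A ≤ (Nat.primeCounting (2 ^ k) : ℝ) := by linarith [hk0.1]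
  have hApos : 0 < A := by rw [hA]; positivity
  have hBA : B ≤ 2 * A := by
    rw [hA, hB, pow_succ, show (2 : ℝ) ^ k * 2 / ((k + 1) * Real.log 2) =
      2 * (2 ^ k / ((k + 1) * Real.log 2)) by ring]
    gcongr
    linarith
  have : (1 + c) * B - (1 - c) * A ≤ (1 + η) * A := by
    rw [hc] at *
    nlinarith
  linarith

/-- `∑_{J ≤ k < 2J} 4^k/k² ≤ (0.1029 + 10⁻⁶) 16^J/J²` for `J ≥ 6000` (split at `2J − J/5`: the top
fifth has `k ≥ 9J/5`, the rest total mass `≤ 16^J/4^{J/5}`). [folklore] -/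
theorem sum_four_pow_div_sq_le (J : ℕ) (hJ : 6000 ≤ J) :
    ∑ k ∈ Finset.Ico J (2 * J), (4 : ℝ) ^ k / (k : ℝ) ^ 2 ≤
      (1029 / 10000 + 1 / 1000000) * ((16 : ℝ) ^ J / (J : ℝ) ^ 2) := by
  have hJ0 : (0 : ℝ) < J := by exact_mod_cast (show 0 < J by omega)
  set W : ℝ := (16 : ℝ) ^ J with hW
  have hW0 : 0 < W := by positivity
  set m := J / 5 with hm
  have hmJ : m ≤ J := Nat.div_le_self J 5
  have h2Jm : (9 : ℝ) / 5 * J ≤ ((2 * J - m : ℕ) : ℝ) := by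
    rw [Nat.cast_sub (by omega)]; push_cast
    have : (m : ℝ) * 5 ≤ J := by exact_mod_cast Nat.div_mul_le_self J 5
    linarith
  rw [← Finset.sum_Ico_consecutive _ (show J ≤ 2 * J - m by omega) (show 2 * J - m ≤ 2 * J by omega)]
  have e : (4 : ℝ) ^ (2 * J - m) * 4 ^ m = W := by
    rw [← pow_add, Nat.sub_add_cancel (by omega), pow_mul, hW]; norm_num
  have h4m : (1000000 : ℝ) ≤ 4 ^ m :=
    calc (1000000 : ℝ) ≤ 4 ^ 10 := by norm_num
      _ ≤ 4 ^ m := pow_le_pow_right₀ (by norm_num) (by omega)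
  have hgeo1 : ∑ k ∈ Finset.Ico J (2 * J - m), (4 : ℝ) ^ k ≤ W / 1000000 := by
    rw [geom_sum_Ico (by norm_num) (by omega)]
    have : (0 : ℝ) ≤ 4 ^ J := by positivity
    have h1 : ((4 : ℝ) ^ (2 * J - m) - 4 ^ J) / (4 - 1) ≤ 4 ^ (2 * J - m) := by
      rw [div_le_iff₀ (by norm_num)]; nlinarith [pow_nonneg (show (0:ℝ) ≤ 4 by norm_num) (2 * J - m)]
    refine h1.trans ?_
    rw [le_div_iff₀ (by norm_num), ← e]
    have : (0 : ℝ) ≤ 4 ^ (2 * J - m) := by positivity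
    nlinarith
  have hgeo2 : ∑ k ∈ Finset.Ico (2 * J - m) (2 * J), (4 : ℝ) ^ k ≤ W / 3 := by
    rw [geom_sum_Ico (by norm_num) (by omega), hW, pow_mul]
    have : (0 : ℝ) ≤ 4 ^ (2 * J - m) := by positivity
    norm_num
    linarith
  have hpart1 : ∑ k ∈ Finset.Ico J (2 * J - m), (4 : ℝ) ^ k / (k : ℝ) ^ 2 ≤ 1 / 1000000 * (W / (J : ℝ) ^ 2) := by
    calc ∑ k ∈ Finset.Ico J (2 * J - m), (4 : ℝ) ^ k / (k : ℝ) ^ 2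
        ≤ ∑ k ∈ Finset.Ico J (2 * J - m), (4 : ℝ) ^ k / (J : ℝ) ^ 2 := by
          refine Finset.sum_le_sum fun k hk => ?_
          rw [Finset.mem_Ico] at hk
          have : (J : ℝ) ≤ k := by exact_mod_cast hk.1
          gcongr
      _ = (∑ k ∈ Finset.Ico J (2 * J - m), (4 : ℝ) ^ k) / (J : ℝ) ^ 2 := by rw [Finset.sum_div]
      _ ≤ (W / 1000000) / (J : ℝ) ^ 2 := by gcongr
      _ = 1 / 1000000 * (W / (J : ℝ) ^ 2) := by ring
  have hpart2 : ∑ k ∈ Finset.Ico (2 * J - m) (2 * J), (4 : ℝ) ^ k / (k : ℝ) ^ 2 ≤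
      1029 / 10000 * (W / (J : ℝ) ^ 2) := by
    have hden : ∀ k ∈ Finset.Ico (2 * J - m) (2 * J), (81 : ℝ) / 25 * (J : ℝ) ^ 2 ≤ (k : ℝ) ^ 2 := by
      intro k hk
      rw [Finset.mem_Ico] at hk
      have hk' : ((2 * J - m : ℕ) : ℝ) ≤ k := by exact_mod_cast hk.1
      have h95 : (9 : ℝ) / 5 * J ≤ k := h2Jm.trans hk'
      nlinarith
    calc ∑ k ∈ Finset.Ico (2 * J - m) (2 * J), (4 : ℝ) ^ k / (k : ℝ) ^ 2
        ≤ ∑ k ∈ Finset.Ico (2 * J - m) (2 * J), (4 : ℝ) ^ k / ((81 : ℝ) / 25 * (J : ℝ) ^ 2) := by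
          refine Finset.sum_le_sum fun k hk => ?_
          exact div_le_div_of_nonneg_left (by positivity) (by positivity) (hden k hk)
      _ = (∑ k ∈ Finset.Ico (2 * J - m) (2 * J), (4 : ℝ) ^ k) / ((81 : ℝ) / 25 * (J : ℝ) ^ 2) := by
          rw [Finset.sum_div]
      _ ≤ (W / 3) / ((81 : ℝ) / 25 * (J : ℝ) ^ 2) := by gcongr
      _ ≤ 1029 / 10000 * (W / (J : ℝ) ^ 2) := by
          rw [div_le_iff₀ (by positivity)]
          have : (0 : ℝ) ≤ W / (J : ℝ) ^ 2 := by positivity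
          have e2 : W / 3 = (W / (J : ℝ) ^ 2) * ((J : ℝ) ^ 2 / 3) := by field_simp
          rw [e2]
          nlinarith
  have hfin : 1 / 1000000 * (W / (J : ℝ) ^ 2) + 1029 / 10000 * (W / (J : ℝ) ^ 2) =
      (1029 / 10000 + 1 / 1000000) * (W / (J : ℝ) ^ 2) := by ring
  linarith

/-- `100 (J + 2) J² ≤ 16^J` for `J ≥ 200` (`16^J = (2^J)^4 > J^4 ≥ 200 J³`). [folklore] -/
theorem hundred_mul_cube_le_sixteen_pow (J : ℕ) (hJ : 200 ≤ J) :
    (100 : ℝ) * (J + 2) * (J : ℝ) ^ 2 ≤ (16 : ℝ) ^ J := by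
  have h2J : (J : ℝ) < 2 ^ J := by exact_mod_cast Nat.lt_two_pow_self
  have hJr : (200 : ℝ) ≤ J := by exact_mod_cast hJ
  have e16 : (16 : ℝ) ^ J = ((2 : ℝ) ^ J) ^ 4 := by rw [← pow_mul, mul_comm, pow_mul]; norm_num
  rw [e16]
  have hJ4 : (J : ℝ) ^ 4 ≤ ((2 : ℝ) ^ J) ^ 4 := by gcongr
  have hJJ : (200 : ℝ) * J ≤ (J : ℝ) * J := by nlinarith
  have h1 : (100 : ℝ) * (J + 2) ≤ (J : ℝ) ^ 2 := by nlinarith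
  have : (100 : ℝ) * (J + 2) * (J : ℝ) ^ 2 ≤ (J : ℝ) ^ 2 * (J : ℝ) ^ 2 := by
    have : (0 : ℝ) ≤ (J : ℝ) ^ 2 := by positivity
    nlinarith
  nlinarith

/-- `e^{−2γ} ≥ 0.3` (`γ < 0.57721571`, `e^{2γ} ≤ e · e^{0.155} ≤ 2.7182818286/0.845 < 10/3`).
[folklore] -/
theorem three_tenths_le_exp_neg_two_mul_eulerMascheroni :
    (3 : ℝ) / 10 ≤ Real.exp (-2 * Real.eulerMascheroniConstant) := by
  have hγ := Literature.Analysis.SpecialFunctions.Real.eulerMascheroniConstant_lt_d8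
  have he := Real.exp_one_lt_d9
  have h1 : Real.exp (2 * Real.eulerMascheroniConstant) ≤ Real.exp 1 * Real.exp (155 / 1000) := by
    rw [← Real.exp_add]; exact Real.exp_le_exp.mpr (by linarith)
  have h2 : Real.exp (155 / 1000) * (845 / 1000) ≤ 1 := by
    have h3 := Real.add_one_le_exp (-(155 / 1000 : ℝ))
    have h4 : Real.exp (-(155 / 1000 : ℝ)) * Real.exp (155 / 1000) = 1 := by
      rw [← Real.exp_add]; norm_num
    nlinarith [Real.exp_pos (155 / 1000 : ℝ)]
  have h5 : Real.exp (2 * Real.eulerMascheroniConstant) ≤ 10 / 3 := by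
    nlinarith [Real.exp_pos (1 : ℝ), Real.exp_pos (155 / 1000 : ℝ)]
  rw [show -2 * Real.eulerMascheroniConstant = -(2 * Real.eulerMascheroniConstant) by ring, Real.exp_neg,
    show (3 : ℝ) / 10 = (10 / 3)⁻¹ by norm_num]
  exact inv_anti₀ (Real.exp_pos _) h5

end PairProducts

namespace SieveSequence

open Filter Finset PairProducts

/-- **The least-`β` form of the `β`-sieve LOWER bound is false as well.** The negated statement —
the body of the former named fact `SieveSequence.jurkat_richert_lower` of `SieveFunctions.lean`,
retired 2026-08-15 and reproduced here verbatim; same hypotheses as in `not_jurkat_richert_upper` —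
asserts `S(𝒜, z; x) ≥ X V(z) (lowerSieveFun κ (θ log x / log z) − ε)` with the least-`β` `f`
(the faithful statement, with Iwaniec's `f_κ`, is `SieveSequence.Iwaniec1980_lower`); for `κ = 2` the
least-`β` `f` is positive already from `s = 1.39…` on and `lowerSieveFun 2 2 ≥ 1.30`
(`lowerSieveFun_two_two_ge`; Iwaniec's `f_2(2) = 0` since `2 < β_2 = 4.83…`), so for the
pair-product sequence at `x = 16^J`, `z = 2^J` the fact would give
`S ≥ (16^J − 1)/3 · e^{−2γ} e^{−50/(J log 2)} (J log 2)⁻² · 1.29 ≥ 0.127 · 16^J/(J log 2)²`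
(`e^{−2γ} ≥ 0.3`), whereas only `1`'s and primes `≥ 2^J` survive the sieve in the blocks
`k < 2J`, and the prime number theorem bounds the sifted sum by
`J + 1 + ∑_{J ≤ k < 2J} (1.01 · 2^k/(k log 2))² ≤ J + 1 + 0.105 · 16^J/(J log 2)²`. [folklore] -/
theorem not_jurkat_richert_lower :
    ¬ ∀ (A : SieveSequence) {κ L θ : ℝ} (_hκ : 1 / 2 ≤ κ) (_hθ : 0 < θ)
        (_hdim : HasIwaniecDimension A.density κ L) (_hlevel : HasLevelOfDistribution A θ)
        (_hsize : ∀ᶠ x : ℝ in atTop, 0 ≤ A.size x),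
        ∀ ε δ : ℝ, 0 < ε → 0 < δ → ∀ᶠ x : ℝ in atTop, ∀ z : ℝ, 2 ≤ z → z ≤ x ^ (θ - δ) →
          A.size x * A.densityProduct (primesProdBelow z) *
              (lowerSieveFun κ (θ * Real.log x / Real.log z) - ε) ≤
            A.sifted x (primesProdBelow z) := by
  intro h
  have hdim : HasIwaniecDimension pairProducts.density 2 (100 * Real.exp (100 / Real.log 2)) :=
    hasIwaniecDimension_two fun p hp => by rw [pairProducts_density, density_prime hp]
  have hsize : ∀ᶠ x : ℝ in atTop, 0 ≤ pairProducts.size x :=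
    Eventually.of_forall fun x => by rw [pairProducts_size]; exact Nat.cast_nonneg _
  have hmain := h pairProducts (by norm_num : (1 : ℝ) / 2 ≤ 2) (by norm_num : (0 : ℝ) < 1 / 2) hdim
    hasLevelOfDistribution_pairProducts hsize (1 / 100) (1 / 4) (by norm_num) (by norm_num)
  have h16 : Tendsto (fun J : ℕ => (16 : ℝ) ^ J) atTop atTop :=
    tendsto_pow_atTop_atTop_of_one_lt (by norm_num)
  have hJev := h16.eventually hmain
  obtain ⟨K₀, hK₀⟩ := eventually_atTop.mp (eventually_card_block_primes_le (η := 1 / 100) (by norm_num))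
  obtain ⟨J, hJ, hJK, hJ6⟩ := (hJev.and ((eventually_ge_atTop K₀).and (eventually_ge_atTop 6000))).exists
  -- notation and basic facts
  have hL1 := Real.log_two_gt_d9
  have hL2 := Real.log_two_lt_d9
  set L := Real.log 2 with hL
  have hL0 : 0 < L := by linarith
  have hJ1 : 1 ≤ J := by omega
  have hJr : (6000 : ℝ) ≤ J := by exact_mod_cast hJ6
  have hJ0 : (0 : ℝ) < J := by linarith
  have hJL4 : (4158 : ℝ) ≤ (J : ℝ) * L :=
    le_trans (by norm_num) (mul_le_mul hJr hL1.le (by norm_num) hJ0.le)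
  set W : ℝ := (16 : ℝ) ^ J with hW
  have hW0 : 0 < W := by positivity
  have hW1 : (1 : ℝ) ≤ W := one_le_pow₀ (by norm_num)
  have hz2 : (2 : ℝ) ≤ (2 : ℝ) ^ J := by
    calc (2 : ℝ) = 2 ^ 1 := by norm_num
      _ ≤ 2 ^ J := pow_le_pow_right₀ one_le_two hJ1
  have hceil : ⌈(2 : ℝ) ^ J⌉₊ = 2 ^ J := by
    rw [show ((2 : ℝ) ^ J) = ((2 ^ J : ℕ) : ℝ) by push_cast; ring, Nat.ceil_natCast]
  -- (1) the "lower bound" at `x = 16^J`, `z = 2^J`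
  have hlow := hJ ((2 : ℝ) ^ J) hz2 (by rw [sixteen_pow_rpow_quarter])
  rw [half_mul_log_sixteen_pow_div J hJ1, pairProducts_densityProduct, hceil] at hlow
  -- (2) the ingredients
  have hf : (129 : ℝ) / 100 ≤ lowerSieveFun 2 2 - 1 / 100 := by linarith [lowerSieveFun_two_two_ge]
  have hX : (W - 1) / 3 ≤ pairProducts.size ((16 : ℝ) ^ J) := size_sixteen_pow_ge J
  have hV : Real.exp (-2 * Real.eulerMascheroniConstant) * (Real.log ((2 : ℝ) ^ J)) ^ (-(2 : ℝ)) *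
      Real.exp (-(50 / Real.log ((2 : ℝ) ^ J))) ≤ ∏ p ∈ Nat.primesBelow (2 ^ J), (1 - (p : ℝ)⁻¹) ^ 2 := by
    have := prod_one_sub_inv_sq_ge hz2
    rwa [hceil] at this
  have hlog2J : Real.log ((2 : ℝ) ^ J) = J * L := by rw [Real.log_pow]
  have hrpow : ((J : ℝ) * L) ^ (-(2 : ℝ)) = 1 / ((J : ℝ) ^ 2 * L ^ 2) := by
    rw [Real.rpow_neg (by positivity), Real.rpow_two, mul_pow, one_div]
  rw [hlog2J, hrpow] at hV
  have hE := three_tenths_le_exp_neg_two_mul_eulerMascheroni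
  have hT : (987 : ℝ) / 1000 ≤ Real.exp (-(50 / (J * L))) := by
    have h1 := Real.add_one_le_exp (-(50 / ((J : ℝ) * L)))
    have h2 : 50 / ((J : ℝ) * L) ≤ 13 / 1000 := by
      rw [div_le_iff₀ (by positivity)]; linarith
    linarith
  -- (3) the lower side
  set R : ℝ := 1 / ((J : ℝ) ^ 2 * L ^ 2) with hR
  have hJL : (0 : ℝ) < (J : ℝ) ^ 2 * L ^ 2 := by positivity
  have hR0 : 0 < R := by positivity
  have hR1 : R ≤ 1 := by
    rw [hR, div_le_one hJL]
    have h1 : (1 : ℝ) ≤ (J : ℝ) * L := by linarith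
    calc (1 : ℝ) = 1 ^ 2 := by norm_num
      _ ≤ ((J : ℝ) * L) ^ 2 := pow_le_pow_left₀ zero_le_one h1 2
      _ = (J : ℝ) ^ 2 * L ^ 2 := by ring
  set Q : ℝ := W / ((J : ℝ) ^ 2 * L ^ 2) with hQ
  have hQR : Q = W * R := by rw [hQ, hR]; ring
  have hV' : (3 : ℝ) / 10 * R * (987 / 1000) ≤ ∏ p ∈ Nat.primesBelow (2 ^ J), (1 - (p : ℝ)⁻¹) ^ 2 := by
    refine le_trans ?_ hV
    rw [hR]
    exact mul_le_mul (mul_le_mul_of_nonneg_right hE hR0.le) hT (by norm_num) (by positivity)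
  have h0 : 0 ≤ ∏ p ∈ Nat.primesBelow (2 ^ J), (1 - (p : ℝ)⁻¹) ^ 2 :=
    Finset.prod_nonneg fun p _ => sq_nonneg _
  have hX0 : 0 ≤ (W - 1) / 3 := by linarith
  have hlower : (1272 : ℝ) / 10000 * ((W - 1) * R) ≤
      pairProducts.sifted ((16 : ℝ) ^ J) (primesProdBelow ((2 : ℝ) ^ J)) := by
    refine le_trans ?_ hlow
    calc (1272 : ℝ) / 10000 * ((W - 1) * R) ≤ (3 / 10 * (987 / 1000) * (129 / 100) / 3) * ((W - 1) * R) :=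
          mul_le_mul_of_nonneg_right (by norm_num) (by nlinarith)
      _ = ((W - 1) / 3) * (3 / 10 * R * (987 / 1000)) * (129 / 100) := by ring
      _ ≤ pairProducts.size ((16 : ℝ) ^ J) * (∏ p ∈ Nat.primesBelow (2 ^ J), (1 - (p : ℝ)⁻¹) ^ 2) *
            (lowerSieveFun 2 2 - 1 / 100) :=
          mul_le_mul (mul_le_mul hX hV' (by positivity) (hX0.trans hX)) hf (by norm_num)
            (mul_nonneg (hX0.trans hX) h0)
  -- (4) the upper side: `S ≤ J + 1 + 1.0201 · (0.1029 + 10⁻⁶) Q`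
  have hupper : pairProducts.sifted ((16 : ℝ) ^ J) (primesProdBelow ((2 : ℝ) ^ J)) ≤
      J + 1 + (10201 : ℝ) / 10000 * ((1029 / 10000 + 1 / 1000000) * Q) := by
    refine (sifted_le_sum_sq_card_primes J hJ1).trans ?_
    have hterm : ∀ k ∈ Finset.Ico J (2 * J),
        ((#((block k).filter Nat.Prime) : ℝ)) ^ 2 ≤ (10201 : ℝ) / 10000 * ((4 : ℝ) ^ k / ((k : ℝ) ^ 2 * L ^ 2)) := by
      intro k hk
      rw [Finset.mem_Ico] at hk
      have hb := hK₀ k (le_trans hJK hk.1)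
      have hk0 : (0 : ℝ) < k := by exact_mod_cast (show 0 < k by omega)
      have hb0 : (0 : ℝ) ≤ #((block k).filter Nat.Prime) := Nat.cast_nonneg _
      calc ((#((block k).filter Nat.Prime) : ℝ)) ^ 2 ≤ ((1 + 1 / 100) * ((2 : ℝ) ^ k / (k * Real.log 2))) ^ 2 :=
            pow_le_pow_left₀ hb0 hb 2
        _ = (10201 : ℝ) / 10000 * ((4 : ℝ) ^ k / ((k : ℝ) ^ 2 * L ^ 2)) := by
            rw [hL, show (4 : ℝ) ^ k = ((2 : ℝ) ^ k) ^ 2 by rw [← pow_mul, mul_comm, pow_mul]; norm_num]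
            field_simp
            ring
    have hsum := sum_four_pow_div_sq_le J hJ6
    have hs2 : ∑ k ∈ Finset.Ico J (2 * J), (4 : ℝ) ^ k / ((k : ℝ) ^ 2 * L ^ 2) ≤
        (1029 / 10000 + 1 / 1000000) * Q := by
      calc ∑ k ∈ Finset.Ico J (2 * J), (4 : ℝ) ^ k / ((k : ℝ) ^ 2 * L ^ 2)
          = (∑ k ∈ Finset.Ico J (2 * J), (4 : ℝ) ^ k / (k : ℝ) ^ 2) / L ^ 2 := by
            rw [sum_div]
            exact sum_congr rfl fun k _ => by rw [div_div]
        _ ≤ ((1029 / 10000 + 1 / 1000000) * ((16 : ℝ) ^ J / (J : ℝ) ^ 2)) / L ^ 2 := by gcongr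
        _ = (1029 / 10000 + 1 / 1000000) * Q := by rw [hQ, hW]; field_simp
    calc (J : ℝ) + 1 + ∑ k ∈ Finset.Ico J (2 * J), ((#((block k).filter Nat.Prime) : ℝ)) ^ 2
        ≤ J + 1 + ∑ k ∈ Finset.Ico J (2 * J), (10201 : ℝ) / 10000 * ((4 : ℝ) ^ k / ((k : ℝ) ^ 2 * L ^ 2)) := by
          gcongr with k hk; exact hterm k hk
      _ = J + 1 + (10201 : ℝ) / 10000 * ∑ k ∈ Finset.Ico J (2 * J), (4 : ℝ) ^ k / ((k : ℝ) ^ 2 * L ^ 2) := by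
          rw [mul_sum]
      _ ≤ J + 1 + (10201 : ℝ) / 10000 * ((1029 / 10000 + 1 / 1000000) * Q) := by gcongr
  -- (5) contradiction: `Q ≥ 100 (J + 2)`
  have hQbig : (100 : ℝ) * (J + 2) ≤ Q := by
    have h16 := hundred_mul_cube_le_sixteen_pow J (by omega)
    have hL21 : L ^ 2 ≤ 1 := by nlinarith
    rw [hQ, le_div_iff₀ hJL, hW]
    calc (100 : ℝ) * (J + 2) * ((J : ℝ) ^ 2 * L ^ 2) ≤ 100 * (J + 2) * ((J : ℝ) ^ 2 * 1) := by gcongr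
      _ = 100 * (J + 2) * (J : ℝ) ^ 2 := by ring
      _ ≤ (16 : ℝ) ^ J := h16
  have hlower' : (1272 : ℝ) / 10000 * Q - 1272 / 10000 * R ≤
      pairProducts.sifted ((16 : ℝ) ^ J) (primesProdBelow ((2 : ℝ) ^ J)) := by
    rw [hQR]; linarith
  linarith

end SieveSequence

end Literature.NumberTheory.Sieve
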